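import Literature.Probability.Percolation.KhSThreeDisorderBoundaryValues
import Literature.Probability.Percolation.TriDiscSeparation
import Literature.Probability.Percolation.TriSiteHalfCounting
import HarnessLib

/-!
# Khristoforov–Smirnov eq. (4) at `k = 3`, PERCOLATION side: on the arc `A₀`, `H₁(z)` and `H₀(z)` are crossing probabilities

Topic `Literature/Probability/Percolation`; lane pcv-sawmu (CriticalPhenomena), three-disorder lineage (after `KhSThreeDisorderObservable`
(Def. 3, Lemma 4), `…Contour` (Cor. 5), `…Normalisation` (`H₁+H₂+H₃ = 1`), `…BoundaryValues` (eq. (4), LOOP side: `H₂(z) = 0` on `A₀`)).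

Khristoforov–Smirnov, *Percolation and O(1) loop model*, arXiv:2111.15612v1. **Lemma 2** (arXiv v1 pp. 2–3; identity and proof p. 3):
«Let u₁, …, u₄ be four distinct mid-edges on ∂Ω. Then there are two possible link patterns of a loop configuration ξ …
P^perc_Ω[∂_{u₁u₂}Ω ↔ ∂_{u₃u₄}Ω] = P^loop_{Ω,{u₁,…,u₄}}[u₁↭u₄, u₂↭u₃]», proved by the map σ ↦ ξ(σ): «a half-edge e belongs to ξ(σ) if and
only if the colors on the left and on the right of e differ … the outer boundary is blue along ∂₁₂Ω and ∂₃₄Ω and is yellow along ∂₂₃Ω and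
∂₄₁Ω. This map is a bijection … moreover ∂_{u₁u₂}Ω ↔ ∂_{u₃u₄}Ω in σ if and only if [u₁↭u₄, u₂↭u₃] in ξ(σ)»; and **eq. (4)** (p. 5): «if
mid-edges u₁, u₂, u₃ lie on the boundary of Ω and a mid-edge z lies on the boundary arc ∂_jΩ then
F(z) = P^perc_Ω[∂_{j+1,z}Ω ↔ ∂_{j−1,j}Ω]·τ^{j−1} + P^perc_Ω[∂_{j,j+1}Ω ↔ ∂_{z,j−1}Ω]·τ^{j+1}».

Status in print: Lemma 2 and eq. (4) are printed and proved in [cite: KhristoforovSmirnov2021, §1.2 Lemma 2 (arXiv v1 pp. 2–3) and §2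
eq. (4) (p. 5)]; this file kernel-checks the printed bijection σ ↦ ξ(σ) and supplies an explicit proof of the printed equivalence
«∂_{u₁u₂}Ω ↔ ∂_{u₃u₄}Ω in σ iff [u₁↭u₄, u₂↭u₃] in ξ(σ)» for the disorders (y₀, z, y₁, y₂) — CONSOLIDATION AT KERNEL RIGOUR (lit-2 g16,
2026-08-23): the route (interface propagation along the strand + Bollobás–Riordan's «but not both») is a longer explicit proof of a
step print treats as evident, not a new statement.

This file proves the PERCOLATION side of eq. (4) for the arc `A₀` of a 3-marked discrete domain `D : TriMarkedDomain 3` (the stretch of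
boundary darts from the mark `0` to the mark `1`; in the printed indexing `∂_jΩ = A₀` with `u_{j+1} = y₀`, `u_{j−1} = y₁`, `u_j = y₂`), i.e.
Lemma 2 for the four disorders `(y₀, z, y₁, y₂)`, in the vocabulary of the parent files (`TXb`, `InClassX`, `classCount`, `Hobs`, `Fobs`):

* the four-change frame `frz m` (blue on the darts of `A₀` before the split position `m` and on `A₁`, yellow after the split and on `A₂`),
  the loop configuration `phiZ m T` of a colouring `T ⊆ G` (bicoloured `H_G`-bonds) and its parity profile `odd_xiDeg_phiZ_iff`
  (odd faces = the three corners XOR the split face `sFace m`);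
* the map `Phi` (`σ ↦ ξ(σ)`, split position `p + 1` or `p` according to the colour of the hexagon `H_g` of `z = (g, o)`, the disorder at
  `z` being carried by the odd endpoint `sOf σ ∈ {v, oppFace v i}`): `Phi_mem_TXb` (image in `W_Ω(y₀,y₁,y₂,z)`, both halves of the
  subdivided edge), `Phi_injOn`, `Phi_image_eq` (★ bijection onto `TXb D v i v ∪ TXb D v i (oppFace v i)`), `exists_eq_Phi`;
* ★ `blueCross_of_reachable` / `yellowCross_of_reachable`: if the strand from `z` ends at `y₁` (resp. `y₀`) the colouring has a blue path
  in `G` from the sub-arc `∂_{y₀ z}` (`arcTo`: tails of the darts at positions `≤ p`) to `A₁` (resp. a yellow path from `∂_{z y₁}` = `arcFrom`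
  to `A₂`) — proved by propagating a bond invariant along the strand (the cells on one side of the interface), with the tree's
  exclusivity `IsTriDisc.not_interleaved` (`not_blueCross_of_yellowCross`) and the loop-side dichotomy `reachable_zero_or_one`;
* ★★ the dictionary `inClassX_one_iff_blueCross`, `inClassX_zero_iff_yellowCross`, the counts `classCount_one_eq_card_blueCross`
  (`N₁(z) = #{σ : ∂_{y₀ z} ↔ A₁ blue}`), `classCount_zero_eq_card_yellowCross`, and the probabilities ★★★ `hobs_one_eq_prob`
  (`H₁(z) = P_{1/2}[∂_{y₀ z}Ω ↔ A₁]`), `hobs_zero_eq_prob` (`H₀(z) = P_{1/2}[∂_{z y₁}Ω ↔ A₂ closed]`), `fobs_eq_crossingProbs`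
  (`F(z) = P[…]·τ⁰ + P[…]·τ¹`, the two probabilities summing to one), and the printed open-colour form `hobs_zero_eq_prob_open`,
  `fobs_eq_openCrossingProbs` (colour flip `card_filter_yellowCross_eq`: complementing the colouring of `G` is a bijection).

Scope. The arc `A₀` only (frame of the parent files); the arcs `A₁`, `A₂` follow by `TriMarkedDomain.rotate` — TODO(general form). The
`H₀` event is delivered by the bijection with a CLOSED (yellow) crossing and converted to the printed open form by the colour-flip
symmetry of `P_{1/2}` (a bijection on the colourings of `G`). Marks are Bollobás–Riordan marks (sites with two outer neighbours);
`z` is any boundary mid-edge of `A₀`, the sub-arcs `∂_{y₀ z}`, `∂_{z y₁}` both contain the hexagon `H_g` of `z` (as sets of hexagons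
touching the closed arcs). Nothing of §3 (the scaling limit) is claimed.

## References
* M. Khristoforov, S. Smirnov, *Percolation and O(1) loop model*, arXiv:2111.15612 (2021): §1.1 (p. 2, «X ↔ Y»), §1.2 (p. 2, the arcs
  ∂_{zw}Ω), Lemma 2 (pp. 2–3; identity and proof p. 3), §2 Definition 3 (p. 4), eq. (4) (p. 5) — arXiv v1 pages.
* B. Bollobás, O. Riordan, *Percolation*, CUP (2006), Ch. 7 §7.2.2 (printed pp. 191–195; k-marked discrete domains and their arcs
  p. 193; Lemma 5 «but not both» p. 193, proof pp. 193–195).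
-/

open Finset

namespace Literature.Probability.Percolation.MarkedLoops

open Literature.Probability.Percolation Literature.Probability.LatticeModels
open Literature.Probability.Percolation.FivePoint (Inc inc_mk_iff side inc_side side_injective xiDeg XiLinked tau
  hexFaceVertices_eq_triple)
open Literature.Probability.Percolation.FivePoint.N5 (sideGraph side_oppFace_oppIdx l1_xiDeg_eq xiLinked_iff_reachable h1_ne_oppFace
  ht3_pair_eq_side)
open TriMarkedDomain

section Frame

variable (D : TriMarkedDomain 3)

/-- the boundary dart at position `n` of the boundary cycle. [folklore] [cite: KhristoforovSmirnov2021, §1.2 Lemma 2, proof (arXiv v1 p. 3)] -/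
noncomputable def bdart (n : ℕ) : Site 2 × Site 2 := triBdryIter D.verts D.base n

/-- **the four-change frame with split position `m`** (`0 ≤ m ≤ pos 1`): the outer colour beyond the boundary dart at position `n` is
BLUE (`true`) on the darts of the stretch `A₀` at positions `< m` and on the stretch `A₁`, YELLOW (`false`) on the darts of `A₀` at
positions `≥ m` and on `A₂` — Khristoforov–Smirnov's boundary colouring «blue along `∂_{12}Ω` and `∂_{34}Ω`, yellow along `∂_{23}Ω` and
`∂_{41}Ω`» for the four disorders `(u₁, u₂, u₃, u₄) = (y₀, z, y₁, y₂)`, the change at `z` sitting between the positions `m - 1` and `m`.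
[cite: KhristoforovSmirnov2021, §1.2 Lemma 2, proof (arXiv v1 p. 3)] -/
noncomputable def frz (m n : ℕ) : Bool :=
  if D.stretchIdx₃ n = 1 then true else if D.stretchIdx₃ n = 2 then false else decide (n % #(triBdryDarts D.verts) < m)

/-- the colour of the cell `x` seen across the bond from `y` under the colouring `T` of `G` and the frame `frz m`.
[cite: KhristoforovSmirnov2021, §1.2 Lemma 2, proof (arXiv v1 p. 3)] -/
noncomputable def czcol (m : ℕ) (T : Finset (Site 2)) (y x : Site 2) : Bool := by
  classical
  exact if x ∈ D.verts then decide (x ∈ T) else frz D m (D.dpos (y, x))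

/-- the bond `{a, b}` is bicoloured under `T` and the frame `frz m`. [cite: KhristoforovSmirnov2021, §1.2 Lemma 2, proof (arXiv v1 p. 3)] -/
def BicZ (m : ℕ) (T : Finset (Site 2)) (a b : Site 2) : Prop := czcol D m T b a ≠ czcol D m T a b

/-- `BicZ` is symmetric. [folklore] [cite: KhristoforovSmirnov2021, §1.2 Lemma 2, proof (arXiv v1 p. 3)] -/
theorem bicZ_comm (m : ℕ) (T : Finset (Site 2)) (a b : Site 2) : BicZ D m T a b ↔ BicZ D m T b a := by
  unfold BicZ; exact ne_comm

open Classical in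
/-- **`ξ(σ)`, the loop configuration of a colouring under the four-change frame**: the bicoloured `H_G`-bonds.
[cite: KhristoforovSmirnov2021, §1.2 Lemma 2, proof (arXiv v1 p. 3): «a half-edge e belongs to ξ(σ) if and only if the colors on the left and on the right of e differ»] -/
noncomputable def phiZ (m : ℕ) (T : Finset (Site 2)) : Finset (Sym2 (Site 2)) :=
  (hBonds D).filter fun e => Sym2.lift ⟨fun a b => BicZ D m T a b, fun a b => propext (bicZ_comm D m T a b)⟩ e

/-- **the fourth disorder `s_m`**: the face spanned by the boundary darts at positions `m - 1` and `m` (where the frame changes colour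
inside `A₀`); for `m = pos i` it is the corner face `y_i`. [cite: KhristoforovSmirnov2021, §1.2 (loop configurations, arXiv v1 pp. 2–3)] -/
noncomputable def sFace (m : ℕ) : HexVertex :=
  leftFace (bdart D (m + (#(triBdryDarts D.verts) - 1))).1 (bdart D (m + (#(triBdryDarts D.verts) - 1))).2

variable {D}

/-! ### the boundary cycle: positions -/

/-- `bdart n` is a boundary dart. [folklore] [cite: KhristoforovSmirnov2021, §1.2 Lemma 2, proof (arXiv v1 p. 3)] -/
theorem bdart_mem (n : ℕ) : bdart D n ∈ triBdryDarts D.verts := triBdryIter_mem D.base_mem n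

/-- the successor of `bdart n` is `bdart (n + 1)`. [folklore] [cite: KhristoforovSmirnov2021, §1.2 Lemma 2, proof (arXiv v1 p. 3)] -/
theorem succ_bdart (n : ℕ) : triBdrySucc D.verts (bdart D n) = bdart D (n + 1) := by
  unfold bdart; rw [triBdryIter_succ]

/-- position of `bdart n`. [folklore] [cite: KhristoforovSmirnov2021, §1.2 Lemma 2, proof (arXiv v1 p. 3)] -/
theorem dpos_bdart (n : ℕ) : D.dpos (bdart D n) = n % #(triBdryDarts D.verts) := D.dpos_iter n

/-- `bdart` is periodic. [folklore] [cite: KhristoforovSmirnov2021, §1.2 Lemma 2, proof (arXiv v1 p. 3)] -/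
theorem bdart_mod (n : ℕ) : bdart D (n % #(triBdryDarts D.verts)) = bdart D n := D.isTriDisc.iter_mod n

/-- a boundary dart is `bdart` of its position. [folklore] [cite: KhristoforovSmirnov2021, §1.2 Lemma 2, proof (arXiv v1 p. 3)] -/
theorem bdart_dpos {d : Site 2 × Site 2} (hd : d ∈ triBdryDarts D.verts) : bdart D (D.dpos d) = d := D.iter_dpos hd

/-- the successor of the dart at position `m + L - 1` is the dart at position `m`. [folklore] [cite: KhristoforovSmirnov2021, §1.2 Lemma 2, proof (arXiv v1 p. 3)] -/
theorem succ_bdart_pred (m : ℕ) : triBdrySucc D.verts (bdart D (m + (#(triBdryDarts D.verts) - 1))) = bdart D m := by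
  rw [succ_bdart]
  have hL := D.isTriDisc.card_pos
  rw [show m + (#(triBdryDarts D.verts) - 1) + 1 = m + #(triBdryDarts D.verts) by omega]
  exact D.isTriDisc.iter_add_card m

/-- the boundary successor is injective on boundary darts. [folklore] [cite: KhristoforovSmirnov2021, §1.2 Lemma 2, proof (arXiv v1 p. 3)] -/
theorem succ_injective {d d' : Site 2 × Site 2} (hd : d ∈ triBdryDarts D.verts) (hd' : d' ∈ triBdryDarts D.verts)
    (h : triBdrySucc D.verts d = triBdrySucc D.verts d') : d = d' := by
  have h1 := D.dpos_succ hd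
  have h2 := D.dpos_succ hd'
  rw [h] at h1
  rw [h1] at h2
  have hL := D.isTriDisc.card_pos
  have hlt := D.dpos_lt hd
  have hlt' := D.dpos_lt hd'
  have : D.dpos d = D.dpos d' := by
    by_cases ha : D.dpos d + 1 < #(triBdryDarts D.verts) <;> by_cases hb : D.dpos d' + 1 < #(triBdryDarts D.verts)
    · rw [Nat.mod_eq_of_lt ha, Nat.mod_eq_of_lt hb] at h2; omega
    · rw [Nat.mod_eq_of_lt ha, show D.dpos d' + 1 = #(triBdryDarts D.verts) by omega, Nat.mod_self] at h2; omega
    · rw [Nat.mod_eq_of_lt hb, show D.dpos d + 1 = #(triBdryDarts D.verts) by omega, Nat.mod_self] at h2; omega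
    · omega
  rw [← bdart_dpos hd, ← bdart_dpos hd', this]

/-- if `succ d = bdart m` then `d = bdart (m + L - 1)`. [folklore] [cite: KhristoforovSmirnov2021, §1.2 Lemma 2, proof (arXiv v1 p. 3)] -/
theorem eq_bdart_pred_of_succ_eq {d : Site 2 × Site 2} (hd : d ∈ triBdryDarts D.verts) {m : ℕ}
    (h : triBdrySucc D.verts d = bdart D m) : d = bdart D (m + (#(triBdryDarts D.verts) - 1)) :=
  succ_injective hd (bdart_mem _) (h.trans (succ_bdart_pred m).symm)

/-! ### the frame: where the colour changes -/

/-- `pos 0 = 0`, `pos 0 < pos 1 < pos 2 < L`. [folklore] [cite: KhristoforovSmirnov2021, §1.2 Lemma 2, proof (arXiv v1 p. 3)] -/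
theorem pos_facts : D.pos 0 = 0 ∧ D.pos 0 < D.pos 1 ∧ D.pos 1 < D.pos 2 ∧ D.pos 2 < #(triBdryDarts D.verts) :=
  ⟨D.pos_zero (by decide), D.pos_lt_pos₃ (by decide), D.pos_lt_pos₃ (by decide), D.pos_lt 2⟩

/-- the frame only depends on the position modulo the length. [folklore] [cite: KhristoforovSmirnov2021, §1.2 Lemma 2, proof (arXiv v1 p. 3)] -/
theorem frz_mod (m n : ℕ) : frz D m (n % #(triBdryDarts D.verts)) = frz D m n := by
  unfold frz; rw [D.stretchIdx_mod₃, Nat.mod_mod]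

/-- stretch index `1`: blue. [folklore] [cite: KhristoforovSmirnov2021, §1.2 Lemma 2, proof (arXiv v1 p. 3)] -/
theorem frz_of_stretchIdx_one {m n : ℕ} (h : D.stretchIdx₃ n = 1) : frz D m n = true := by
  unfold frz; rw [if_pos h]

/-- stretch index `2`: yellow. [folklore] [cite: KhristoforovSmirnov2021, §1.2 Lemma 2, proof (arXiv v1 p. 3)] -/
theorem frz_of_stretchIdx_two {m n : ℕ} (h : D.stretchIdx₃ n = 2) : frz D m n = false := by
  unfold frz; rw [if_neg (by rw [h]; decide), if_pos h]

/-- stretch index `0`: blue iff the position is `< m`. [folklore] [cite: KhristoforovSmirnov2021, §1.2 Lemma 2, proof (arXiv v1 p. 3)] -/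
theorem frz_of_stretchIdx_zero {m n : ℕ} (h : D.stretchIdx₃ n = 0) : frz D m n = decide (n % #(triBdryDarts D.verts) < m) := by
  unfold frz; rw [if_neg (by rw [h]; decide), if_neg (by rw [h]; decide)]

/-- positions of stretch index `0` are `< pos 1`. [folklore] [cite: KhristoforovSmirnov2021, §1.2 Lemma 2, proof (arXiv v1 p. 3)] -/
theorem mod_lt_pos_one_of_stretchIdx_zero {n : ℕ} (h : D.stretchIdx₃ n = 0) : n % #(triBdryDarts D.verts) < D.pos 1 := by
  have := (D.pos_stretchIdx_le₃ n).2
  rw [h, D.nextPos_of_lt₃ 0 (by decide)] at this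
  exact this

/-- positions `< pos 1` have stretch index `0`. [folklore] [cite: KhristoforovSmirnov2021, §1.2 Lemma 2, proof (arXiv v1 p. 3)] -/
theorem stretchIdx_zero_of_lt {n : ℕ} (h : n % #(triBdryDarts D.verts) < D.pos 1) : D.stretchIdx₃ n = 0 := by
  rw [← D.stretchIdx_mod₃]
  exact D.stretchIdx_eq_of_mem₃ (i := 0) (by rw [pos_facts.1]; exact Nat.zero_le _) (by rw [D.nextPos_of_lt₃ 0 (by decide)]; exact h)

/-- positions of stretch index `1` are in `[pos 1, pos 2)`. [folklore] [cite: KhristoforovSmirnov2021, §1.2 Lemma 2, proof (arXiv v1 p. 3)] -/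
theorem mod_mem_of_stretchIdx_one {n : ℕ} (h : D.stretchIdx₃ n = 1) :
    D.pos 1 ≤ n % #(triBdryDarts D.verts) ∧ n % #(triBdryDarts D.verts) < D.pos 2 := by
  have := D.pos_stretchIdx_le₃ n
  rw [h, D.nextPos_of_lt₃ 1 (by decide)] at this
  exact this

/-- positions of stretch index `2` are `≥ pos 2`. [folklore] [cite: KhristoforovSmirnov2021, §1.2 Lemma 2, proof (arXiv v1 p. 3)] -/
theorem pos_two_le_of_stretchIdx_two {n : ℕ} (h : D.stretchIdx₃ n = 2) : D.pos 2 ≤ n % #(triBdryDarts D.verts) := by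
  have := (D.pos_stretchIdx_le₃ n).1
  rw [h] at this
  exact this

/-- **no change away from the marks and `m`**: consecutive positions whose second is neither a mark nor `m` carry the same stretch
index, the same frame colour and the same side of the split. [cite: KhristoforovSmirnov2021, §1.2 Lemma 2, proof (arXiv v1 p. 3)] -/
theorem frame_succ_of_not_change {m n : ℕ} (hmark : ∀ i : Fin 3, (n + 1) % #(triBdryDarts D.verts) ≠ D.pos i)
    (hz : (n + 1) % #(triBdryDarts D.verts) ≠ m) :
    D.stretchIdx₃ (n + 1) = D.stretchIdx₃ n ∧ frz D m (n + 1) = frz D m n ∧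
      (n % #(triBdryDarts D.verts) < m ↔ (n + 1) % #(triBdryDarts D.verts) < m) := by
  have hL := D.isTriDisc.card_pos
  have hs := D.stretchIdx_succ_eq₃ hmark
  have h0 : (n + 1) % #(triBdryDarts D.verts) ≠ 0 := by rw [← pos_facts.1]; exact hmark 0
  have hsucc := succ_mod_eq (n := n) hL h0
  have hiff : (n % #(triBdryDarts D.verts) < m ↔ (n + 1) % #(triBdryDarts D.verts) < m) := by
    rw [hsucc]; omega
  refine ⟨hs, ?_, hiff⟩
  unfold frz
  rw [hs]
  split_ifs with h1 h2
  · rfl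
  · rfl
  · rw [Bool.decide_congr hiff.symm]

/-- **at a mark**: the colour changes at the marks `1`, `2` and at the mark `0` unless `m = 0`; at the mark `1` unless `m = pos 1`.
[cite: KhristoforovSmirnov2021, §1.2 Lemma 2, proof (arXiv v1 p. 3)] -/
theorem frz_succ_ne_iff_of_mark {m n : ℕ} (hm : m ≤ D.pos 1) {i : Fin 3} (hi : (n + 1) % #(triBdryDarts D.verts) = D.pos i) :
    frz D m (n + 1) ≠ frz D m n ↔ D.pos i ≠ m := by
  obtain ⟨h00, h01, h12, h2L⟩ := pos_facts (D := D)
  have hL := D.isTriDisc.card_pos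
  obtain ⟨hs1, hs0⟩ := D.stretchIdx_of_succ_mod_eq_pos₃ hi
  fin_cases i
  · -- mark 0: from stretch 2 (yellow) to position 0 (blue iff 0 < m)
    simp only [Fin.zero_eta, Fin.isValue] at hi hs1 hs0 ⊢
    have e2 : D.stretchIdx₃ n = 2 := by rw [hs0]; decide
    rw [frz_of_stretchIdx_two e2, frz_of_stretchIdx_zero hs1, hi, h00]
    constructor
    · intro h e; rw [← e] at h; simp at h
    · intro h; have : 0 < m := by omega
      simp [this]
  · simp only [Fin.mk_one, Fin.isValue] at hi hs1 hs0 ⊢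
    have e0 : D.stretchIdx₃ n = 0 := by rw [hs0]; decide
    rw [frz_of_stretchIdx_one hs1, frz_of_stretchIdx_zero e0]
    have hn : n % #(triBdryDarts D.verts) = D.pos 1 - 1 := by
      have := succ_mod_eq (n := n) hL (by rw [hi]; omega)
      omega
    rw [hn]
    constructor
    · intro h e; rw [e] at h; simp at h; omega
    · intro h
      have : ¬ (D.pos 1 - 1 < m) := by omega
      simp [this]
  · simp only [Fin.reduceFinMk, Fin.isValue] at hi hs1 hs0 ⊢
    have e1 : D.stretchIdx₃ n = 1 := by rw [hs0]; decide
    rw [frz_of_stretchIdx_two hs1, frz_of_stretchIdx_one e1]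
    simp only [ne_eq, Bool.false_eq_true, not_false_eq_true, true_iff]
    omega

/-- **at the split position `m`** (not a mark): the colour changes. [cite: KhristoforovSmirnov2021, §1.2 Lemma 2, proof (arXiv v1 p. 3)] -/
theorem frz_succ_ne_of_split {m n : ℕ} (hm : m ≤ D.pos 1) (hmark : ∀ i : Fin 3, (n + 1) % #(triBdryDarts D.verts) ≠ D.pos i)
    (hz : (n + 1) % #(triBdryDarts D.verts) = m) : frz D m (n + 1) ≠ frz D m n := by
  have hL := D.isTriDisc.card_pos
  obtain ⟨h00, h01, h12, h2L⟩ := pos_facts (D := D)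
  have hs := D.stretchIdx_succ_eq₃ hmark
  have h0 : (n + 1) % #(triBdryDarts D.verts) ≠ 0 := by rw [← h00]; exact hmark 0
  have hsucc := succ_mod_eq (n := n) hL h0
  have hm1 : m ≠ D.pos 1 := fun e => hmark 1 (hz.trans e)
  have hlt : (n + 1) % #(triBdryDarts D.verts) < D.pos 1 := by rw [hz]; omega
  have e0' : D.stretchIdx₃ (n + 1) = 0 := stretchIdx_zero_of_lt hlt
  have e0 : D.stretchIdx₃ n = 0 := hs ▸ e0'
  rw [frz_of_stretchIdx_zero e0', frz_of_stretchIdx_zero e0, hz]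
  have hn : n % #(triBdryDarts D.verts) = m - 1 := by omega
  rw [hn]
  have h2 : m - 1 < m := by omega
  simp [h2]

end Frame

section Config

variable {D : TriMarkedDomain 3}

/-- Auxiliary. [folklore] -/
private theorem fin3_cases_z (v j : Fin 3) : j = v ∨ j = v + 1 ∨ j = v + 2 := by revert v j; decide

/-- Auxiliary. [folklore] -/
private theorem fin3_add_one_add_two (j : Fin 3) : j + 1 + 2 = j := by rw [add_assoc]; exact add_eq_left.2 (by decide)

/-- Auxiliary. [folklore] -/
private theorem fin3_add_one_add_one (j : Fin 3) : j + 1 + 1 = j + 2 := by rw [add_assoc]; rfl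

/-- Auxiliary. [folklore] -/
private theorem fin3_ne_add_one (j : Fin 3) : j ≠ j + 1 := by revert j; decide

/-- Auxiliary. [folklore] -/
private theorem fin3_ne_add_two (j : Fin 3) : j ≠ j + 2 := by revert j; decide

/-- Auxiliary. [folklore] -/
private theorem fin3_add_two_ne_add_one (j : Fin 3) : j + 2 ≠ j + 1 := by revert j; decide

/-- Auxiliary. [folklore] -/
private theorem fin6_add_two_ne (k : Fin 6) : k + 1 + 1 ≠ k := by revert k; decide

/-! ### the loop configuration of a colouring: membership -/

/-- `BicZ` across a bond of `G`. [cite: KhristoforovSmirnov2021, §1.2 Lemma 2, proof (arXiv v1 p. 3)] -/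
theorem bicZ_iff_of_mem_mem (m : ℕ) (T : Finset (Site 2)) {u v : Site 2} (hu : u ∈ D.verts) (hv : v ∈ D.verts) :
    BicZ D m T u v ↔ (u ∈ T ↔ v ∉ T) := by
  unfold BicZ czcol
  rw [if_pos hu, if_pos hv]
  by_cases h1 : u ∈ T <;> by_cases h2 : v ∈ T <;> simp [h1, h2]

/-- `BicZ` across a boundary dart: the inner state differs from the frame colour. [cite: KhristoforovSmirnov2021, §1.2 Lemma 2, proof (arXiv v1 p. 3)] -/
theorem bicZ_iff_of_mem_not_mem (m : ℕ) (T : Finset (Site 2)) {u w : Site 2} (hu : u ∈ D.verts) (hw : w ∉ D.verts) :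
    BicZ D m T u w ↔ (u ∈ T ↔ frz D m (D.dpos (u, w)) = false) := by
  unfold BicZ czcol
  rw [if_pos hu, if_neg hw]
  by_cases h1 : u ∈ T <;> cases frz D m (D.dpos (u, w)) <;> simp [h1]

open Classical in
/-- membership of a bond in `phiZ`. [cite: KhristoforovSmirnov2021, §1.2 Lemma 2, proof (arXiv v1 p. 3)] -/
theorem mk_mem_phiZ_iff (m : ℕ) (T : Finset (Site 2)) {u v : Site 2} (hadj : triGraph.Adj u v) (hG : u ∈ D.verts ∨ v ∈ D.verts) :
    s(u, v) ∈ phiZ D m T ↔ BicZ D m T u v := by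
  unfold phiZ
  rw [Finset.mem_filter, Sym2.lift_mk]
  exact ⟨fun h => h.2, fun h => ⟨mem_hBonds D hadj hG, h⟩⟩

/-- `phiZ ⊆ hBonds`. [cite: KhristoforovSmirnov2021, §1.2 Lemma 2, proof (arXiv v1 p. 3)] -/
theorem phiZ_subset (m : ℕ) (T : Finset (Site 2)) : phiZ D m T ⊆ hBonds D := by
  classical
  unfold phiZ; exact Finset.filter_subset _ _

/-- an inner bond in `phiZ`. [cite: KhristoforovSmirnov2021, §1.2 Lemma 2, proof (arXiv v1 p. 3)] -/
theorem mk_mem_phiZ_iff_of_mem_mem (m : ℕ) (T : Finset (Site 2)) {u v : Site 2} (hadj : triGraph.Adj u v) (hu : u ∈ D.verts)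
    (hv : v ∈ D.verts) : s(u, v) ∈ phiZ D m T ↔ (u ∈ T ↔ v ∉ T) := by
  rw [mk_mem_phiZ_iff m T hadj (Or.inl hu), bicZ_iff_of_mem_mem m T hu hv]

/-- a boundary bond in `phiZ`. [cite: KhristoforovSmirnov2021, §1.2 Lemma 2, proof (arXiv v1 p. 3)] -/
theorem mk_mem_phiZ_iff_of_mem_not_mem (m : ℕ) (T : Finset (Site 2)) {u w : Site 2} (hadj : triGraph.Adj u w) (hu : u ∈ D.verts)
    (hw : w ∉ D.verts) : s(u, w) ∈ phiZ D m T ↔ (u ∈ T ↔ frz D m (D.dpos (u, w)) = false) := by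
  rw [mk_mem_phiZ_iff m T hadj (Or.inl hu), bicZ_iff_of_mem_not_mem m T hu hw]

/-! ### faces and their boundary darts -/

/-- the left face determines the boundary dart (a face is the left face of its three anticlockwise darts, only one of which has its tail
in `G` and its head outside). [folklore] [cite: KhristoforovSmirnov2021, §1.2 Lemma 2, proof (arXiv v1 p. 3)] -/
theorem eq_of_leftFace_eq {d d' : Site 2 × Site 2} (hd : d ∈ triBdryDarts D.verts) (hd' : d' ∈ triBdryDarts D.verts)
    (h : leftFace d.1 d.2 = leftFace d'.1 d'.2) : d = d' := by
  obtain ⟨hu, hv, hadj⟩ := mem_triBdryDarts.1 hd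
  obtain ⟨hu', hv', hadj'⟩ := mem_triBdryDarts.1 hd'
  obtain ⟨j, hj, hj1⟩ := exists_eq_faceVertex_of_adj hadj
  obtain ⟨j', hj', hj1'⟩ := exists_eq_faceVertex_of_adj hadj'
  rw [← h] at hj' hj1'
  rcases fin3_cases_z j j' with e | e | e
  · rw [e] at hj' hj1'
    exact Prod.ext (hj.trans hj'.symm) (hj1.trans hj1'.symm)
  · exfalso; apply hv
    rw [hj1, ← e, ← hj']; exact hu'
  · exfalso; apply hv'
    rw [hj1', e, fin3_add_two_add_one, ← hj]; exact hu

/-- a touching face with an outer vertex has an anticlockwise dart from `G` to the outside. [folklore] [cite: KhristoforovSmirnov2021, §1.2 Lemma 2, proof (arXiv v1 p. 3)] -/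
theorem exists_inner_outer {F : HexVertex} (hF : F ∈ triFacesTouching D.verts) {w : Fin 3} (hw : faceVertex F w ∉ D.verts) :
    ∃ j : Fin 3, faceVertex F j ∈ D.verts ∧ faceVertex F (j + 1) ∉ D.verts := by
  obtain ⟨x, hxG, hx⟩ := mem_triFacesTouching.1 hF
  obtain ⟨a, rfl⟩ := mem_hexFaceVertices_iff_faceVertex.1 hx
  by_cases h1 : faceVertex F (a + 1) ∈ D.verts
  · by_cases h2 : faceVertex F (a + 2) ∈ D.verts
    · exfalso
      rcases fin3_cases_z a w with e | e | e
      · exact hw (e ▸ hxG)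
      · exact hw (e ▸ h1)
      · exact hw (e ▸ h2)
    · exact ⟨a + 1, h1, by rw [fin3_add_one_add_one]; exact h2⟩
  · exact ⟨a, hxG, h1⟩

/-- the anticlockwise dart `(x_j, x_{j+1})` of `F` from `G` to the outside: a boundary dart with left face `F`, whose successor is
`(x_{j+2}, x_{j+1})` or `(x_j, x_{j+2})`. [folklore] [cite: KhristoforovSmirnov2021, §1.2 Lemma 2, proof (arXiv v1 p. 3)] -/
theorem faceDart_facts {F : HexVertex} {j : Fin 3} (hj : faceVertex F j ∈ D.verts) (hj1 : faceVertex F (j + 1) ∉ D.verts) :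
    (faceVertex F j, faceVertex F (j + 1)) ∈ triBdryDarts D.verts ∧
      leftFace (faceVertex F j) (faceVertex F (j + 1)) = F ∧
      triBdrySucc D.verts (faceVertex F j, faceVertex F (j + 1)) =
        (if faceVertex F (j + 2) ∈ D.verts then (faceVertex F (j + 2), faceVertex F (j + 1)) else (faceVertex F j, faceVertex F (j + 2))) :=
  ⟨D.faceDart_mem₃ hj hj1, leftFace_faceVertex F j, D.succ_faceDart₃⟩

/-- **the split face**: for a boundary dart `d` with left face `F`, `F = s_m` iff the successor of `d` sits at position `m`.
[cite: KhristoforovSmirnov2021, §1.2 (loop configurations, arXiv v1 pp. 2–3)] -/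
theorem leftFace_eq_sFace_iff {m : ℕ} (hm : m < #(triBdryDarts D.verts)) {d : Site 2 × Site 2} (hd : d ∈ triBdryDarts D.verts) :
    leftFace d.1 d.2 = sFace D m ↔ (D.dpos d + 1) % #(triBdryDarts D.verts) = m := by
  constructor
  · intro h
    have e := eq_of_leftFace_eq hd (bdart_mem _) h
    have := D.dpos_succ hd
    rw [e, succ_bdart_pred, dpos_bdart, Nat.mod_eq_of_lt hm] at this
    rw [e]; exact this.symm
  · intro h
    have hs : triBdrySucc D.verts d = bdart D m := by
      rw [← bdart_dpos (triBdrySucc_mem hd), D.dpos_succ hd, h]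
    have e := eq_bdart_pred_of_succ_eq hd hs
    unfold sFace; rw [← e]

/-- the split face has the outer vertex `(bdart (m + L - 1)).2`. [folklore] [cite: KhristoforovSmirnov2021, §1.2 Lemma 2, proof (arXiv v1 p. 3)] -/
theorem sFace_outer (m : ℕ) : (bdart D (m + (#(triBdryDarts D.verts) - 1))).2 ∈ hexFaceVertices (sFace D m) ∧
    (bdart D (m + (#(triBdryDarts D.verts) - 1))).2 ∉ D.verts := by
  obtain ⟨hu, hv, hadj⟩ := mem_triBdryDarts.1 (bdart_mem (D := D) (m + (#(triBdryDarts D.verts) - 1)))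
  refine ⟨?_, hv⟩
  unfold sFace; rw [hexFaceVertices_leftFace hadj]; simp

/-- **a corner face is the left face of the preceding dart of its mark**: for a boundary dart `d = (x_j, x_{j+1})` of `F`, the
successor of `d` is a marked dart iff `F` is a corner face. [cite: KhristoforovSmirnov2021, §1.2 (loop configurations, arXiv v1 pp. 2–3)] -/
theorem succ_eq_pos_iff_corner {F : HexVertex} {j : Fin 3} (hj : faceVertex F j ∈ D.verts) (hj1 : faceVertex F (j + 1) ∉ D.verts) :
    (∃ i : Fin 3, (D.dpos (faceVertex F j, faceVertex F (j + 1)) + 1) % #(triBdryDarts D.verts) = D.pos i) ↔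
      ∃ i : Fin 3, IsCornerFace D i F := by
  obtain ⟨hd, hlf, hsucc⟩ := faceDart_facts (D := D) hj hj1
  constructor
  · rintro ⟨i, hi⟩
    refine ⟨i, ?_⟩
    have h1 : (faceVertex F j, faceVertex F (j + 1)) = predDart D i := by
      have := iter_eq_predDart (D := D) hi
      rwa [D.iter_dpos hd] at this
    have h2 : triBdrySucc D.verts (faceVertex F j, faceVertex F (j + 1)) = D.markDart i := by
      have := iter_succ_eq_markDart (D := D) hi
      rwa [triBdryIter_succ, D.iter_dpos hd] at this
    rw [hsucc] at h2
    have em : D.markSite i = faceVertex F j := by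
      have := congrArg Prod.fst h1; rw [predDart_fst] at this; exact this.symm
    have hout : faceVertex F (j + 2) ∉ D.verts := by
      intro hin
      rw [if_pos hin] at h2
      have : D.markSite i = faceVertex F (j + 2) := (congrArg Prod.fst h2).symm
      exact fin3_ne_add_two j (faceVertex_injective F (em.symm.trans this))
    rw [if_neg hout] at h2
    unfold IsCornerFace
    rw [hexFaceVertices_eq_triple F j, em, ← congrArg Prod.snd h2, ← congrArg Prod.snd h1, Finset.pair_comm]
  · rintro ⟨i, hc⟩
    obtain ⟨v, hv, hv1, hv2, hor⟩ := isCornerFace_typeII D hc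
    have hjv : j = v := by
      rcases fin3_cases_z v j with e | e | e
      · exact e
      · exact absurd (e ▸ hj) hv1
      · exact absurd (e ▸ hj) hv2
    subst hjv
    refine ⟨i, ?_⟩
    rcases hor with ⟨e1, -⟩ | ⟨e1, e2⟩
    · have hp : (faceVertex F j, faceVertex F (j + 1)) = predDart D i := Prod.ext (by rw [predDart_fst]; exact hv) e1
      rw [hp]; exact dpos_predDart_succ D i
    · -- the impossible orientation: `markDart i = (x_j, x_{j+1})`, `predDart i = (x_j, x_{j+2})`, `succ predDart = markDart`
      exfalso
      have hp : predDart D i = (faceVertex F j, faceVertex F (j + 2)) := (Prod.ext (by rw [predDart_fst]; exact hv) e2).symm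
      have hmk : D.markDart i = (faceVertex F j, faceVertex F (j + 1)) := (Prod.ext hv e1).symm
      have key := succ_predDart D i
      rw [hp, hmk] at key
      -- compute the successor of the clockwise dart `(x_j, x_{j+2})`
      obtain ⟨k, hk⟩ := (triGraph_adj_iff_triDir _ _).1 (TriMarkedDomain.adj_faceVertex_succ F j)
      have hk2 : faceVertex F (j + 2) = faceVertex F j + triDir (k + 1) := by
        rw [← triLeftApex_faceVertex F j, hk, triLeftApex_add_triDir]
      unfold triBdrySucc at key
      rw [hk2, triLeftApex_add_triDir] at key
      split_ifs at key with hin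
      · have h2 := congrArg Prod.snd key
        simp only at h2
        rw [← hk2] at h2
        exact fin3_add_two_ne_add_one j (faceVertex_injective F h2)
      · have h2 := congrArg Prod.snd key
        simp only at h2
        rw [hk] at h2
        exact fin6_add_two_ne k (triDir_injective (add_left_cancel h2))

/-! ### parity of `phiZ`: the odd faces are the corners XOR the split face -/

/-- Auxiliary: parity of a filter on `Fin 3` as an XOR. [folklore] -/
private theorem odd_card_filter_fin3_iff (b : Fin 3 → Bool) (j : Fin 3) :
    Odd #((Finset.univ : Finset (Fin 3)).filter fun i => b i = true) ↔ ((b j ^^ b (j + 1)) ^^ b (j + 2)) = true := by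
  revert b j; decide

open Classical in
/-- `xiDeg` as an XOR of the three side indicators, listed from `j`. [folklore] -/
private theorem odd_xiDeg_iff_xor (ξ : Finset (Sym2 (Site 2))) (F : HexVertex) (j : Fin 3) :
    Odd (xiDeg ξ F) ↔ Xor (Xor (side F j ∈ ξ) (side F (j + 1) ∈ ξ)) (side F (j + 2) ∈ ξ) := by
  rw [l1_xiDeg_eq]
  have key : ((Finset.univ : Finset (Fin 3)).filter fun i => side F i ∈ ξ) =
      (Finset.univ : Finset (Fin 3)).filter fun i => decide (side F i ∈ ξ) = true :=
    Finset.filter_congr fun i _ => by rw [decide_eq_true_iff]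
  rw [key, odd_card_filter_fin3_iff _ j]
  by_cases h0 : side F j ∈ ξ <;> by_cases h1 : side F (j + 1) ∈ ξ <;> by_cases h2 : side F (j + 2) ∈ ξ <;>
    simp [h0, h1, h2, Xor]

/-- the three sides listed from `j`: `side F (j+2) = {x_j, x_{j+1}}`, `side F (j+1) = {x_{j+2}, x_j}`, `side F j = {x_{j+1}, x_{j+2}}`. [folklore] -/
private theorem sides_from (F : HexVertex) (j : Fin 3) :
    side F (j + 2) = s(faceVertex F j, faceVertex F (j + 1)) ∧ side F (j + 1) = s(faceVertex F (j + 2), faceVertex F j) ∧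
      side F j = s(faceVertex F (j + 1), faceVertex F (j + 2)) := by
  unfold side
  rw [fin3_add_two_add_one, fin3_add_two_add_two, fin3_add_one_add_one, fin3_add_one_add_two]
  exact ⟨rfl, rfl, rfl⟩

/-- **parity at a face with an outer vertex**: odd iff the frame changes colour between the two boundary darts of the face.
[cite: KhristoforovSmirnov2021, §1.2 Lemma 2, proof (arXiv v1 p. 3)] -/
theorem odd_xiDeg_phiZ_iff_frz (m : ℕ) (T : Finset (Site 2)) {F : HexVertex} {j : Fin 3} (hj : faceVertex F j ∈ D.verts)
    (hj1 : faceVertex F (j + 1) ∉ D.verts) :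
    Odd (xiDeg (phiZ D m T) F) ↔
      frz D m (D.dpos (faceVertex F j, faceVertex F (j + 1)) + 1) ≠ frz D m (D.dpos (faceVertex F j, faceVertex F (j + 1))) := by
  obtain ⟨hd, hlf, hsucc⟩ := faceDart_facts (D := D) hj hj1
  have hfrz : frz D m (D.dpos (faceVertex F j, faceVertex F (j + 1)) + 1) =
      frz D m (D.dpos (triBdrySucc D.verts (faceVertex F j, faceVertex F (j + 1)))) := by
    rw [D.dpos_succ hd, frz_mod]
  rw [hfrz, odd_xiDeg_iff_xor _ F j]
  obtain ⟨s2, s1, s0⟩ := sides_from F j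
  rw [s2, s1, s0]
  have a01 : triGraph.Adj (faceVertex F j) (faceVertex F (j + 1)) := TriMarkedDomain.adj_faceVertex_succ F j
  have a12 : triGraph.Adj (faceVertex F (j + 1)) (faceVertex F (j + 2)) := by
    have := TriMarkedDomain.adj_faceVertex_succ F (j + 1); rwa [fin3_add_one_add_one] at this
  have a20 : triGraph.Adj (faceVertex F (j + 2)) (faceVertex F j) := by
    have := TriMarkedDomain.adj_faceVertex_succ F (j + 2); rwa [fin3_add_two_add_one] at this
  rw [mk_mem_phiZ_iff_of_mem_not_mem m T a01 hj hj1]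
  by_cases h2 : faceVertex F (j + 2) ∈ D.verts
  · rw [if_pos h2] at hsucc
    have hA : s(faceVertex F (j + 2), faceVertex F j) ∈ phiZ D m T ↔ (faceVertex F (j + 2) ∈ T ↔ faceVertex F j ∉ T) :=
      mk_mem_phiZ_iff_of_mem_mem m T a20 h2 hj
    have hB : s(faceVertex F (j + 1), faceVertex F (j + 2)) ∈ phiZ D m T ↔
        (faceVertex F (j + 2) ∈ T ↔ frz D m (D.dpos (faceVertex F (j + 2), faceVertex F (j + 1))) = false) := by
      rw [Sym2.eq_swap]; exact mk_mem_phiZ_iff_of_mem_not_mem m T a12.symm h2 hj1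
    rw [hsucc, hA, hB]
    by_cases t0 : faceVertex F j ∈ T <;> by_cases t2 : faceVertex F (j + 2) ∈ T <;>
      cases frz D m (D.dpos (faceVertex F j, faceVertex F (j + 1))) <;>
      cases frz D m (D.dpos (faceVertex F (j + 2), faceVertex F (j + 1))) <;> simp [t0, t2, Xor]
  · rw [if_neg h2] at hsucc
    have hno : s(faceVertex F (j + 1), faceVertex F (j + 2)) ∉ phiZ D m T := by
      intro h
      obtain ⟨a, b, hab, ha, -⟩ := exists_rep_of_mem_hBonds D (phiZ_subset m T h)
      rcases Sym2.eq_iff.1 hab with ⟨e1, -⟩ | ⟨-, e2⟩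
      · exact hj1 (e1 ▸ ha)
      · exact h2 (e2 ▸ ha)
    have hA : s(faceVertex F (j + 2), faceVertex F j) ∈ phiZ D m T ↔
        (faceVertex F j ∈ T ↔ frz D m (D.dpos (faceVertex F j, faceVertex F (j + 2))) = false) := by
      rw [Sym2.eq_swap]; exact mk_mem_phiZ_iff_of_mem_not_mem m T a20.symm hj h2
    rw [hsucc, hA]
    by_cases t0 : faceVertex F j ∈ T <;>
      cases frz D m (D.dpos (faceVertex F j, faceVertex F (j + 1))) <;>
      cases frz D m (D.dpos (faceVertex F j, faceVertex F (j + 2))) <;> simp [t0, hno, Xor]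

/-- **parity at a face inside `G`**: even. [cite: KhristoforovSmirnov2021, §1.2 Lemma 2, proof (arXiv v1 p. 3)] -/
theorem not_odd_xiDeg_phiZ_of_inner (m : ℕ) (T : Finset (Site 2)) {F : HexVertex} (hF : ∀ w, faceVertex F w ∈ D.verts) :
    ¬ Odd (xiDeg (phiZ D m T) F) := by
  have key := odd_xiDeg_iff_xor (phiZ D m T) F 0
  obtain ⟨s2, s1, s0⟩ := sides_from F 0
  have e1 : (0 : Fin 3) + 1 = 1 := rfl
  have e2 : (0 : Fin 3) + 2 = 2 := rfl
  rw [e1, e2] at key s2 s1 s0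
  rw [key, s2, s1, s0]
  have a01 : triGraph.Adj (faceVertex F 0) (faceVertex F 1) := TriMarkedDomain.adj_faceVertex_succ F 0
  have a12 : triGraph.Adj (faceVertex F 1) (faceVertex F 2) := TriMarkedDomain.adj_faceVertex_succ F 1
  have a20 : triGraph.Adj (faceVertex F 2) (faceVertex F 0) := TriMarkedDomain.adj_faceVertex_succ F 2
  rw [mk_mem_phiZ_iff_of_mem_mem m T a01 (hF _) (hF _), mk_mem_phiZ_iff_of_mem_mem m T a12 (hF _) (hF _),
    mk_mem_phiZ_iff_of_mem_mem m T a20 (hF _) (hF _)]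
  by_cases t0 : faceVertex F 0 ∈ T <;> by_cases t1 : faceVertex F 1 ∈ T <;> by_cases t2 : faceVertex F 2 ∈ T <;>
    simp [t0, t1, t2, Xor]

/-- ★ **(P) THE DISORDERS OF `ξ(σ)` ARE THE THREE CORNERS AND THE SPLIT FACE** (as a XOR: when the split position is a mark, `m = 0`
or `m = pos 1`, the split face IS that corner and it is even). [cite: KhristoforovSmirnov2021, §1.2 Lemma 2, proof (arXiv v1 p. 3): «ξ(σ) … a loop configuration with disorders at u₁, …, u₄»] -/
theorem odd_xiDeg_phiZ_iff {m : ℕ} (hm : m ≤ D.pos 1) (T : Finset (Site 2)) {F : HexVertex} (hF : F ∈ triFacesTouching D.verts) :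
    Odd (xiDeg (phiZ D m T) F) ↔ Xor (∃ i : Fin 3, IsCornerFace D i F) (F = sFace D m) := by
  have hmL : m < #(triBdryDarts D.verts) := lt_of_le_of_lt hm (pos_facts.2.2.1.trans pos_facts.2.2.2)
  by_cases hout : ∃ w, faceVertex F w ∉ D.verts
  · obtain ⟨w, hw⟩ := hout
    obtain ⟨j, hj, hj1⟩ := exists_inner_outer hF hw
    obtain ⟨hd, hlf, -⟩ := faceDart_facts (D := D) hj hj1
    set n := D.dpos (faceVertex F j, faceVertex F (j + 1)) with hn
    have hsf : F = sFace D m ↔ (n + 1) % #(triBdryDarts D.verts) = m := by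
      constructor
      · intro e; exact (leftFace_eq_sFace_iff hmL hd).1 (hlf.trans e)
      · intro h; exact hlf.symm.trans ((leftFace_eq_sFace_iff hmL hd).2 h)
    rw [odd_xiDeg_phiZ_iff_frz m T hj hj1, ← succ_eq_pos_iff_corner hj hj1, hsf]
    by_cases hmark : ∃ i : Fin 3, (n + 1) % #(triBdryDarts D.verts) = D.pos i
    · obtain ⟨i, hi⟩ := hmark
      rw [frz_succ_ne_iff_of_mark hm hi]
      constructor
      · intro hne; exact Or.inl ⟨⟨i, hi⟩, fun e => hne (hi.symm.trans e)⟩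
      · rintro (⟨-, hne⟩ | ⟨e, hno⟩)
        · exact fun e => hne (hi ▸ e)
        · exact absurd ⟨i, hi⟩ hno
    · push Not at hmark
      by_cases hz : (n + 1) % #(triBdryDarts D.verts) = m
      · have hne := frz_succ_ne_of_split hm hmark hz
        exact ⟨fun _ => Or.inr ⟨hz, fun ⟨i, hi⟩ => hmark i hi⟩, fun _ => hne⟩
      · obtain ⟨-, heq, -⟩ := frame_succ_of_not_change (m := m) hmark hz
        constructor
        · intro h; exact absurd heq h
        · rintro (⟨⟨i, hi⟩, -⟩ | ⟨e, -⟩)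
          · exact absurd hi (hmark i)
          · exact absurd e hz
  · push Not at hout
    constructor
    · intro h; exact absurd h (not_odd_xiDeg_phiZ_of_inner m T hout)
    · rintro (⟨⟨i, hc⟩, -⟩ | ⟨e, -⟩)
      · obtain ⟨v, -, hv1, -, -⟩ := isCornerFace_typeII D hc
        exact absurd (hout (v + 1)) hv1
      · obtain ⟨hmem, hnot⟩ := sFace_outer (D := D) m
        rw [← e] at hmem
        obtain ⟨w, hw⟩ := mem_hexFaceVertices_iff_faceVertex.1 hmem
        exact absurd (hw ▸ hout w) hnot

/-- **(P) as a parity profile**: `phiZ m T` has odd faces `corners Δ {s_m}`, in the `loopSpaceX` form. [cite: KhristoforovSmirnov2021, §1.2 Lemma 2, proof (arXiv v1 p. 3)] -/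
theorem phiZ_parity {m : ℕ} (hm : m ≤ D.pos 1) (T : Finset (Site 2)) :
    ∀ F ∈ triFacesTouching D.verts, (Odd (xiDeg (phiZ D m T) F) ↔ Xor (∃ j : Fin 3, IsCornerFace D j F) (F = sFace D m)) :=
  fun _ hF => odd_xiDeg_phiZ_iff hm T hF

end Config

section ZMap

variable {D : TriMarkedDomain 3}

/-! ### the colouring ↦ loop-configuration map at a boundary mid-edge `z` of `A₀` -/

open Classical in
/-- **the split position of a colouring**: for the mid-edge `z` dual to the boundary dart `(g, o)` at position `p`, the frame changes
between the positions `p` and `p + 1` if `g` is blue (the half-edge of `z` towards the successor face is then the bicoloured one),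
between `p - 1` and `p` if `g` is yellow. [cite: KhristoforovSmirnov2021, §1.2 Lemma 2, proof (arXiv v1 p. 3)] -/
noncomputable def mOf (D : TriMarkedDomain 3) (g o : Site 2) (T : Finset (Site 2)) : ℕ :=
  if g ∈ T then D.dpos (g, o) + 1 else D.dpos (g, o)

/-- **`Φ(σ)`**: Khristoforov–Smirnov's loop configuration `ξ(σ) ∈ W_Ω(u₁,u₂,u₃,z)` of a colouring `σ = T` of `G`, for the boundary
mid-edge `z` dual to `(g, o)`. [cite: KhristoforovSmirnov2021, §1.2 Lemma 2, proof (arXiv v1 p. 3)] -/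
noncomputable def Phi (D : TriMarkedDomain 3) (g o : Site 2) (T : Finset (Site 2)) : Finset (Sym2 (Site 2)) := phiZ D (mOf D g o T) T

/-- the odd endpoint of `Φ(σ)` at `z` (which half of the subdivided edge carries the half-edge of `ξ(σ)`). [cite: KhristoforovSmirnov2021, §1.2 Lemma 2, proof (arXiv v1 p. 3)] -/
noncomputable def sOf (D : TriMarkedDomain 3) (g o : Site 2) (T : Finset (Site 2)) : HexVertex := sFace D (mOf D g o T)

/-- the boundary successor moves every dart. [folklore] [cite: KhristoforovSmirnov2021, §1.2 Lemma 2, proof (arXiv v1 p. 3)] -/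
theorem succ_ne_self {d : Site 2 × Site 2} (hd : d ∈ triBdryDarts D.verts) : triBdrySucc D.verts d ≠ d := by
  obtain ⟨hu, hv, hadj⟩ := mem_triBdryDarts.1 hd
  have h1 := triGraph_adj_triLeftApex_left hadj
  have h2 := triGraph_adj_triLeftApex_right hadj
  unfold triBdrySucc
  split_ifs with hw
  · intro e; exact h1.ne (congrArg Prod.fst e).symm
  · intro e; exact h2.ne (congrArg Prod.snd e)

section Z

variable {g o : Site 2} (hg : g ∈ D.verts) (ho : o ∉ D.verts) (hadj : triGraph.Adj g o) (hst : D.stretchIdx₃ (D.dpos (g, o)) = 0)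
include hg ho hadj

/-- the dart of `z` is a boundary dart. [folklore] [cite: KhristoforovSmirnov2021, §1.2 Lemma 2, proof (arXiv v1 p. 3)] -/
theorem zdart_mem : (g, o) ∈ triBdryDarts D.verts := mem_triBdryDarts.2 ⟨hg, ho, hadj⟩

include hst

/-- the position `p` of `z` is `< pos 1` (stretch `A₀`). [folklore] [cite: KhristoforovSmirnov2021, §1.2 Lemma 2, proof (arXiv v1 p. 3)] -/
theorem zpos_lt_pos_one : D.dpos (g, o) < D.pos 1 := by
  have := mod_lt_pos_one_of_stretchIdx_zero hst
  rwa [Nat.mod_eq_of_lt (D.dpos_lt (zdart_mem hg ho hadj))] at this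

/-- the split position is `≤ pos 1`. [folklore] [cite: KhristoforovSmirnov2021, §1.2 Lemma 2, proof (arXiv v1 p. 3)] -/
theorem mOf_le (T : Finset (Site 2)) : mOf D g o T ≤ D.pos 1 := by
  have := zpos_lt_pos_one hg ho hadj hst
  unfold mOf; split_ifs <;> omega

/-- **`z` itself is never bicoloured**: the bond `s(g, o)` is not in `Φ(σ)` (the disorder at `z` is carried by the half-edge, i.e. by
the odd endpoint `sOf`). [cite: KhristoforovSmirnov2021, §1.2 Lemma 2, proof (arXiv v1 p. 3)] -/
theorem zbond_not_mem_Phi (T : Finset (Site 2)) : s(g, o) ∉ Phi D g o T := by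
  have hd := zdart_mem hg ho hadj
  have hpL := D.dpos_lt hd
  unfold Phi
  rw [mk_mem_phiZ_iff_of_mem_not_mem _ T hadj hg ho, frz_of_stretchIdx_zero hst, Nat.mod_eq_of_lt hpL]
  unfold mOf
  by_cases hT : g ∈ T
  · rw [if_pos hT]; simp [hT]
  · rw [if_neg hT]; simp [hT]

omit hst in
/-- the split face for blue `g` is the left face of `(g, o)`. [folklore] [cite: KhristoforovSmirnov2021, §1.2 Lemma 2, proof (arXiv v1 p. 3)] -/
theorem sFace_pos_succ : sFace D (D.dpos (g, o) + 1) = leftFace g o := by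
  have hd := zdart_mem hg ho hadj
  unfold sFace
  rw [show D.dpos (g, o) + 1 + (#(triBdryDarts D.verts) - 1) = D.dpos (g, o) + #(triBdryDarts D.verts) by
    have := D.isTriDisc.card_pos; omega]
  unfold bdart
  rw [D.isTriDisc.iter_add_card, D.iter_dpos hd]

omit hst in
/-- the split face for yellow `g`: its successor dart is `(g, o)`, so it contains `g` and `o`. [folklore] [cite: KhristoforovSmirnov2021, §1.2 Lemma 2, proof (arXiv v1 p. 3)] -/
theorem sFace_pos_inc : g ∈ hexFaceVertices (sFace D (D.dpos (g, o))) ∧ o ∈ hexFaceVertices (sFace D (D.dpos (g, o))) := by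
  have hd := zdart_mem hg ho hadj
  unfold sFace
  set d := bdart D (D.dpos (g, o) + (#(triBdryDarts D.verts) - 1)) with hdd
  have hsucc : triBdrySucc D.verts d = (g, o) := by
    rw [hdd, succ_bdart_pred, bdart_dpos hd]
  obtain ⟨hu1, hv2, hadj'⟩ := mem_triBdryDarts.1 (bdart_mem (D := D) (D.dpos (g, o) + (#(triBdryDarts D.verts) - 1)))
  rw [← hdd] at hu1 hv2 hadj'
  rw [hexFaceVertices_leftFace hadj']
  simp only [Finset.mem_insert, Finset.mem_singleton]
  unfold triBdrySucc at hsucc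
  split_ifs at hsucc with hw
  · have e1 := congrArg Prod.fst hsucc; have e2 := congrArg Prod.snd hsucc
    simp only at e1 e2
    exact ⟨Or.inr (Or.inr e1.symm), Or.inr (Or.inl e2.symm)⟩
  · have e1 := congrArg Prod.fst hsucc; have e2 := congrArg Prod.snd hsucc
    simp only at e1 e2
    exact ⟨Or.inl e1.symm, Or.inr (Or.inr e2.symm)⟩

omit hst in
/-- the two candidate odd endpoints differ. [folklore] [cite: KhristoforovSmirnov2021, §1.2 Lemma 2, proof (arXiv v1 p. 3)] -/
theorem sFace_succ_ne : sFace D (D.dpos (g, o) + 1) ≠ sFace D (D.dpos (g, o)) := by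
  have hd := zdart_mem hg ho hadj
  rw [sFace_pos_succ hg ho hadj]
  intro e
  have := eq_of_leftFace_eq (d := (g, o)) hd (bdart_mem _) e
  have hs := succ_bdart_pred (D := D) (D.dpos (g, o))
  rw [← this, bdart_dpos hd] at hs
  exact succ_ne_self hd hs

omit hst in
/-- `sOf T` is incident to the bond of `z`. [folklore] [cite: KhristoforovSmirnov2021, §1.2 Lemma 2, proof (arXiv v1 p. 3)] -/
theorem inc_sOf (T : Finset (Site 2)) : Inc (sOf D g o T) s(g, o) := by
  rw [inc_mk_iff]
  unfold sOf mOf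
  by_cases hT : g ∈ T
  · rw [if_pos hT, sFace_pos_succ hg ho hadj, hexFaceVertices_leftFace hadj]; simp
  · rw [if_neg hT]; exact sFace_pos_inc hg ho hadj

omit hst in
/-- `sOf T` is one of the two faces `v`, `oppFace v i` of the edge dual to `z` (`side v i = s(g, o)`). [cite: KhristoforovSmirnov2021, §2 Definition 3 (arXiv v1 p. 4)] -/
theorem sOf_mem_pair {v : HexVertex} (hv : AllSides D v) {i : Fin 3} (he : side v i = s(g, o)) (T : Finset (Site 2)) :
    sOf D g o T ∈ ({v, oppFace v i} : Finset HexVertex) := by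
  have hb : side v i ∈ hBonds D := hv i
  have hvT : v ∈ triFacesTouching D.verts := mem_touching_of_side_mem D hb
  have hoT : oppFace v i ∈ triFacesTouching D.verts :=
    mem_touching_of_side_mem D (j := oppIdx v i) (by rw [side_oppFace_oppIdx]; exact hb)
  have hsT : sOf D g o T ∈ triFacesTouching D.verts :=
    mem_triFacesTouching.2 ⟨g, hg, (inc_mk_iff.1 (inc_sOf hg ho hadj T)).1⟩
  have iv : Inc v (side v i) := inc_side v i
  have io : Inc (oppFace v i) (side v i) := by rw [← side_oppFace_oppIdx]; exact inc_side _ _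
  have is : Inc (sOf D g o T) (side v i) := by rw [he]; exact inc_sOf hg ho hadj T
  rw [Finset.mem_insert, Finset.mem_singleton]
  exact eq_or_eq_of_inc_three D hb hvT hoT hsT iv io is (h1_ne_oppFace v i)

/-- ★ **`Φ(σ) ∈ W_Ω(y₀,y₁,y₂,z)`**: the loop configuration of a colouring lies in the XOR space at `z` with odd endpoint `sOf σ`.
[cite: KhristoforovSmirnov2021, §1.2 Lemma 2, proof (arXiv v1 p. 3): «a loop configuration with disorders at u₁, …, u₄»] -/
theorem Phi_mem_TXb {v : HexVertex} {i : Fin 3} (he : side v i = s(g, o)) (T : Finset (Site 2)) :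
    Phi D g o T ∈ TXb D v i (sOf D g o T) := by
  rw [mem_TXb_iff]
  constructor
  · intro b hb
    rw [Finset.mem_erase, he]
    refine ⟨fun e => ?_, phiZ_subset _ T hb⟩
    rw [e] at hb; exact zbond_not_mem_Phi hg ho hadj hst T hb
  · intro F hF
    unfold Phi sOf
    rw [odd_xiDeg_phiZ_iff (mOf_le hg ho hadj hst T) T hF, Finset.mem_symmDiff, Finset.mem_singleton, ← h1_mem_corners_iff]
    constructor
    · rintro (⟨hc, hn⟩ | ⟨hs, hn⟩)
      · exact Or.inl ⟨hc, hn⟩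
      · exact Or.inr ⟨hs, hn⟩
    · rintro (⟨hc, hn⟩ | ⟨hs, hn⟩)
      · exact Or.inl ⟨hc, hn⟩
      · exact Or.inr ⟨hs, hn⟩

end Z

/-! ### injectivity and the image (the map is a bijection onto both halves) -/

/-- Auxiliary. [folklore] -/
private theorem iff_propagate_z {a b a' b' : Prop} (h : (a ↔ ¬b) ↔ (a' ↔ ¬b')) : (a ↔ a') ↔ (b ↔ b') := by
  by_cases ha : a <;> by_cases hb : b <;> by_cases ha' : a' <;> by_cases hb' : b' <;> simp_all

/-- Auxiliary. [folklore] -/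
private theorem iff_anchor_z {a a' c : Prop} (h : (a ↔ c) ↔ (a' ↔ c)) : a ↔ a' := by
  by_cases ha : a <;> by_cases ha' : a' <;> by_cases hk : c <;> simp_all

/-- **injectivity for a fixed frame**: two colourings of `G` with the same `phiZ m` agree on `G` (flood fill from the base site, anchored at
the base dart). [cite: KhristoforovSmirnov2021, §1.2 Lemma 2, proof (arXiv v1 p. 3): «This map is a bijection»] -/
theorem phiZ_inj {m : ℕ} {T T' : Finset (Site 2)} (hξ : phiZ D m T = phiZ D m T') : ∀ u ∈ D.verts, (u ∈ T ↔ u ∈ T') := by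
  have hstep : ∀ u v : Site 2, u ∈ D.verts → v ∈ D.verts → triGraph.Adj u v →
      ((u ∈ T ↔ u ∈ T') ↔ (v ∈ T ↔ v ∈ T')) := by
    intro u v hu hv hadj
    have h1 := mk_mem_phiZ_iff_of_mem_mem m T hadj hu hv
    have h2 := mk_mem_phiZ_iff_of_mem_mem m T' hadj hu hv
    rw [hξ] at h1
    exact iff_propagate_z (h1.symm.trans h2)
  have hbase : (D.base.1 ∈ T ↔ D.base.1 ∈ T') := by
    obtain ⟨hu, hw, hadj⟩ := mem_triBdryDarts.1 D.base_mem
    have h1 := mk_mem_phiZ_iff_of_mem_not_mem m T hadj hu hw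
    have h2 := mk_mem_phiZ_iff_of_mem_not_mem m T' hadj hu hw
    rw [hξ] at h1
    exact iff_anchor_z (h1.symm.trans h2)
  intro u hu
  have hreach := D.connected.preconnected ⟨D.base.1, Finset.mem_coe.2 (mem_triBdryDarts.1 D.base_mem).1⟩ ⟨u, Finset.mem_coe.2 hu⟩
  obtain ⟨p⟩ := hreach
  suffices h : ∀ (a b : ↥((D.verts : Finset (Site 2)) : Set (Site 2))) (q : (triGraph.induce ((D.verts : Finset (Site 2)) : Set (Site 2))).Walk a b),
      ((a : Site 2) ∈ T ↔ (a : Site 2) ∈ T') → ((b : Site 2) ∈ T ↔ (b : Site 2) ∈ T') from h _ _ p hbase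
  intro a b q
  induction q with
  | nil => exact id
  | @cons u' x' b' hadj q' ih =>
    intro ha
    have hadj' : triGraph.Adj (u' : Site 2) (x' : Site 2) := hadj
    exact ih ((hstep u' x' (Finset.mem_coe.1 u'.2) (Finset.mem_coe.1 x'.2) hadj').1 ha)

/-- **XOR spaces with different odd endpoints are disjoint.** [cite: KhristoforovSmirnov2021, §1.2 (loop configurations, arXiv v1 pp. 2–3)] -/
theorem not_mem_TXb_of_mem_TXb {v : HexVertex} {i : Fin 3} {s s' : HexVertex} (hs : s ∈ triFacesTouching D.verts) (hne : s ≠ s')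
    {ξ : Finset (Sym2 (Site 2))} (h : ξ ∈ TXb D v i s) : ξ ∉ TXb D v i s' := by
  intro h'
  rw [mem_TXb_iff] at h h'
  have h1 := h.2 s hs
  have h2 := h'.2 s hs
  rw [Finset.mem_symmDiff, Finset.mem_singleton] at h1 h2
  by_cases hc : s ∈ corners D
  · have hodd : Odd (xiDeg ξ s) := h2.2 (Or.inl ⟨hc, hne⟩)
    rcases h1.1 hodd with ⟨-, hn⟩ | ⟨-, hn⟩
    · exact hn rfl
    · exact hn hc
  · have hodd : Odd (xiDeg ξ s) := h1.2 (Or.inr ⟨rfl, hc⟩)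
    rcases h2.1 hodd with ⟨hc', -⟩ | ⟨e, -⟩
    · exact hc hc'
    · exact hne e

section Z2

variable {g o : Site 2} (hg : g ∈ D.verts) (ho : o ∉ D.verts) (hadj : triGraph.Adj g o) (hst : D.stretchIdx₃ (D.dpos (g, o)) = 0)
  {v : HexVertex} (hv : AllSides D v) {i : Fin 3} (he : side v i = s(g, o))
include hg ho hadj hst hv he

omit hst hv he in
/-- `sOf T` is a touching face. [folklore] [cite: KhristoforovSmirnov2021, §1.2 Lemma 2, proof (arXiv v1 p. 3)] -/
theorem sOf_touching (T : Finset (Site 2)) : sOf D g o T ∈ triFacesTouching D.verts :=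
  mem_triFacesTouching.2 ⟨g, hg, (inc_mk_iff.1 (inc_sOf hg ho hadj T)).1⟩

omit hv in
/-- colourings differing at `g` have different images (they lie in different halves). [cite: KhristoforovSmirnov2021, §1.2 Lemma 2, proof (arXiv v1 p. 3)] -/
theorem mem_iff_mem_of_Phi_eq {T T' : Finset (Site 2)} (h : Phi D g o T = Phi D g o T') : (g ∈ T ↔ g ∈ T') := by
  by_contra hne
  have hm : sOf D g o T ≠ sOf D g o T' := by
    unfold sOf mOf
    have hne' := sFace_succ_ne hg ho hadj
    by_cases h1 : g ∈ T
    · have h2 : g ∉ T' := fun h2 => hne ⟨fun _ => h2, fun _ => h1⟩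
      rw [if_pos h1, if_neg h2]; exact hne'
    · have h2 : g ∈ T' := by by_contra h2; exact hne ⟨fun h => absurd h h1, fun h => absurd h h2⟩
      rw [if_neg h1, if_pos h2]; exact hne'.symm
  have h1 := Phi_mem_TXb hg ho hadj hst he T
  have h2 := Phi_mem_TXb hg ho hadj hst he T'
  rw [h] at h1
  exact not_mem_TXb_of_mem_TXb (sOf_touching hg ho hadj T) hm h1 h2

omit hv in
/-- ★ **injectivity of `Φ` on the colourings of `G`.** [cite: KhristoforovSmirnov2021, §1.2 Lemma 2, proof (arXiv v1 p. 3): «This map is a bijection»] -/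
theorem Phi_injOn : Set.InjOn (Phi D g o) (↑(D.verts.powerset) : Set (Finset (Site 2))) := by
  intro T hT T' hT' h
  have hT1 := Finset.mem_powerset.1 (Finset.mem_coe.1 hT)
  have hT2 := Finset.mem_powerset.1 (Finset.mem_coe.1 hT')
  have hgg := mem_iff_mem_of_Phi_eq hg ho hadj hst he h
  have hm : mOf D g o T = mOf D g o T' := by
    unfold mOf
    by_cases h1 : g ∈ T
    · rw [if_pos h1, if_pos (hgg.1 h1)]
    · rw [if_neg h1, if_neg (fun h2 => h1 (hgg.2 h2))]
  have h' : phiZ D (mOf D g o T) T = phiZ D (mOf D g o T) T' := by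
    have := h; unfold Phi at this; rwa [← hm] at this
  ext u
  constructor
  · intro hu; exact ((phiZ_inj h') u (hT1 hu)).1 hu
  · intro hu; exact ((phiZ_inj h') u (hT2 hu)).2 hu

/-- ★ **surjectivity**: every configuration of the XOR space at `z` (either half) is `Φ` of a colouring of `G` (injectivity + the count
`#W = 2 ^ #G` over both halves, `card_TXb_add_card_TXb`). [cite: KhristoforovSmirnov2021, §1.2 (arXiv v1 p. 2): «exactly 2^{#Faces(Ω)} loop configurations with given disorders»; Lemma 2, proof (p. 3)] -/
theorem Phi_image_eq : (D.verts.powerset).image (Phi D g o) = TXb D v i v ∪ TXb D v i (oppFace v i) := by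
  classical
  apply Finset.eq_of_subset_of_card_le
  · intro ξ hξ
    obtain ⟨T, -, rfl⟩ := Finset.mem_image.1 hξ
    have hm := Phi_mem_TXb hg ho hadj hst he T
    have hs := sOf_mem_pair hg ho hadj hv he T
    rw [Finset.mem_insert, Finset.mem_singleton] at hs
    rw [Finset.mem_union]
    rcases hs with e | e
    · exact Or.inl (e ▸ hm)
    · exact Or.inr (e ▸ hm)
  · rw [Finset.card_image_of_injOn (Phi_injOn hg ho hadj hst he), Finset.card_powerset]
    calc #(TXb D v i v ∪ TXb D v i (oppFace v i)) ≤ #(TXb D v i v) + #(TXb D v i (oppFace v i)) := Finset.card_union_le _ _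
      _ = 2 ^ #D.verts := card_TXb_add_card_TXb D (by decide) hv i

/-- every configuration of a half is the image of a colouring with the matching odd endpoint. [cite: KhristoforovSmirnov2021, §1.2 Lemma 2, proof (arXiv v1 p. 3)] -/
theorem exists_eq_Phi {s : HexVertex} (hs : s ∈ ({v, oppFace v i} : Finset HexVertex)) {ξ : Finset (Sym2 (Site 2))}
    (hξ : ξ ∈ TXb D v i s) : ∃ T : Finset (Site 2), T ⊆ D.verts ∧ Phi D g o T = ξ ∧ sOf D g o T = s := by
  classical
  have hmem : ξ ∈ (D.verts.powerset).image (Phi D g o) := by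
    rw [Phi_image_eq hg ho hadj hst hv he, Finset.mem_union]
    rw [Finset.mem_insert, Finset.mem_singleton] at hs
    rcases hs with rfl | rfl
    · exact Or.inl hξ
    · exact Or.inr hξ
  obtain ⟨T, hT, rfl⟩ := Finset.mem_image.1 hmem
  refine ⟨T, Finset.mem_powerset.1 hT, rfl, ?_⟩
  by_contra hne
  exact not_mem_TXb_of_mem_TXb (sOf_touching hg ho hadj T) hne (Phi_mem_TXb hg ho hadj hst he T) hξ

end Z2

end ZMap

section Crossing

variable {D : TriMarkedDomain 3}

/-! ### the sub-arcs cut at `z` and the crossing events -/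

/-- **the sub-arc `∂_{y₀ z}` of `A₀` as hexagons**: the tails of the boundary darts at positions `0, …, p` (`p` the position of the dart of
`z`; both `v₀` and the hexagon `H_g` of `z` included). [cite: KhristoforovSmirnov2021, §1.2 (arXiv v1 p. 2: «the counterclockwise arc ∂_{zw}Ω»)] -/
noncomputable def arcTo (D : TriMarkedDomain 3) (g o : Site 2) : Finset (Site 2) :=
  ((Finset.range (D.dpos (g, o) + 1)).image (bdart D)).image Prod.fst

/-- **the sub-arc `∂_{z y₁}` of `A₀` as hexagons**: the tails of the boundary darts at positions `p, …, pos 1 - 1` (`H_g` and `v₁` included).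
[cite: KhristoforovSmirnov2021, §1.2 (arXiv v1 p. 2: «the counterclockwise arc ∂_{zw}Ω»)] -/
noncomputable def arcFrom (D : TriMarkedDomain 3) (g o : Site 2) : Finset (Site 2) :=
  ((Finset.Ico (D.dpos (g, o)) (D.pos 1)).image (bdart D)).image Prod.fst

/-- **`∂_{y₀ z}Ω ↔ ∂_{y₁ y₂}Ω` in blue**: a path of blue (`∈ T`) sites of `G` from the sub-arc `∂_{y₀ z}` to the arc `A₁`
(Khristoforov–Smirnov's `X ↔ Y`: «there is a σ-blue path between two sets X and Y», arXiv v1 p. 2). [cite: KhristoforovSmirnov2021, §1.1 (arXiv v1 p. 2) and §2 eq. (4) (p. 5)] -/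
def BlueCross (D : TriMarkedDomain 3) (g o : Site 2) (T : Finset (Site 2)) : Prop :=
  ∃ a ∈ arcTo D g o, ∃ b ∈ D.arc 1, PathIn triGraph ((D.verts : Set (Site 2)) ∩ (↑T : Set (Site 2))) a b

/-- **`∂_{z y₁}Ω ↔ ∂_{y₂ y₀}Ω` in yellow**: a path of yellow (`∉ T`) sites of `G` from the sub-arc `∂_{z y₁}` to the arc `A₂`.
[cite: KhristoforovSmirnov2021, §1.1 (arXiv v1 p. 2) and §2 eq. (4) (p. 5)] -/
def YellowCross (D : TriMarkedDomain 3) (g o : Site 2) (T : Finset (Site 2)) : Prop :=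
  ∃ a ∈ arcFrom D g o, ∃ b ∈ D.arc 2, PathIn triGraph ((D.verts : Set (Site 2)) ∩ (↑T : Set (Site 2))ᶜ) a b

/-- the tail of a boundary dart lies on the arc of its stretch. [folklore] [cite: KhristoforovSmirnov2021, §1.2 Lemma 2, proof (arXiv v1 p. 3)] -/
theorem fst_mem_arc_stretchIdx {d : Site 2 × Site 2} (hd : d ∈ triBdryDarts D.verts) : d.1 ∈ D.arc (D.stretchIdx₃ (D.dpos d)) := by
  have := D.iter_fst_mem_arc₃ (D.dpos d)
  rwa [D.iter_dpos hd] at this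

/-- the tail of a boundary dart at position `≤ p` lies on `∂_{y₀ z}`. [folklore] [cite: KhristoforovSmirnov2021, §1.2 Lemma 2, proof (arXiv v1 p. 3)] -/
theorem fst_mem_arcTo {g o : Site 2} {d : Site 2 × Site 2} (hd : d ∈ triBdryDarts D.verts) (hle : D.dpos d ≤ D.dpos (g, o)) :
    d.1 ∈ arcTo D g o := by
  unfold arcTo
  refine Finset.mem_image.2 ⟨d, Finset.mem_image.2 ⟨D.dpos d, Finset.mem_range.2 (by omega), bdart_dpos hd⟩, rfl⟩

/-- the tail of a boundary dart of `A₀` at position `≥ p` lies on `∂_{z y₁}`. [folklore] [cite: KhristoforovSmirnov2021, §1.2 Lemma 2, proof (arXiv v1 p. 3)] -/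
theorem fst_mem_arcFrom {g o : Site 2} {d : Site 2 × Site 2} (hd : d ∈ triBdryDarts D.verts) (h0 : D.stretchIdx₃ (D.dpos d) = 0)
    (hle : D.dpos (g, o) ≤ D.dpos d) : d.1 ∈ arcFrom D g o := by
  have hlt := mod_lt_pos_one_of_stretchIdx_zero h0
  rw [Nat.mod_eq_of_lt (D.dpos_lt hd)] at hlt
  unfold arcFrom
  refine Finset.mem_image.2 ⟨d, Finset.mem_image.2 ⟨D.dpos d, Finset.mem_Ico.2 ⟨hle, hlt⟩, bdart_dpos hd⟩, rfl⟩

/-- a site of `∂_{y₀ z}` is the tail of a dart at a position `≤ p`. [folklore] [cite: KhristoforovSmirnov2021, §1.2 Lemma 2, proof (arXiv v1 p. 3)] -/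
theorem exists_of_mem_arcTo {g o : Site 2} {x : Site 2} (hx : x ∈ arcTo D g o) : ∃ n, n ≤ D.dpos (g, o) ∧ (bdart D n).1 = x := by
  unfold arcTo at hx
  obtain ⟨d, hd, rfl⟩ := Finset.mem_image.1 hx
  obtain ⟨n, hn, rfl⟩ := Finset.mem_image.1 hd
  exact ⟨n, by rw [Finset.mem_range] at hn; omega, rfl⟩

/-- a site of `∂_{z y₁}` is the tail of a dart at a position in `[p, pos 1)`. [folklore] [cite: KhristoforovSmirnov2021, §1.2 Lemma 2, proof (arXiv v1 p. 3)] -/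
theorem exists_of_mem_arcFrom {g o : Site 2} {x : Site 2} (hx : x ∈ arcFrom D g o) :
    ∃ n, D.dpos (g, o) ≤ n ∧ n < D.pos 1 ∧ (bdart D n).1 = x := by
  unfold arcFrom at hx
  obtain ⟨d, hd, rfl⟩ := Finset.mem_image.1 hx
  obtain ⟨n, hn, rfl⟩ := Finset.mem_image.1 hd
  rw [Finset.mem_Ico] at hn
  exact ⟨n, hn.1, hn.2, rfl⟩

/-- blue frame colour: stretch `A₁`, or `A₀` before the split. [folklore] [cite: KhristoforovSmirnov2021, §1.2 Lemma 2, proof (arXiv v1 p. 3)] -/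
theorem frz_eq_true_iff (m n : ℕ) : frz D m n = true ↔ D.stretchIdx₃ n = 1 ∨ (D.stretchIdx₃ n = 0 ∧ n % #(triBdryDarts D.verts) < m) := by
  unfold frz
  have h3 : ∀ j : Fin 3, j = 0 ∨ j = 1 ∨ j = 2 := by decide
  rcases h3 (D.stretchIdx₃ n) with h | h | h <;> simp [h]

/-- yellow frame colour: stretch `A₂`, or `A₀` after the split. [folklore] [cite: KhristoforovSmirnov2021, §1.2 Lemma 2, proof (arXiv v1 p. 3)] -/
theorem frz_eq_false_iff (m n : ℕ) : frz D m n = false ↔ D.stretchIdx₃ n = 2 ∨ (D.stretchIdx₃ n = 0 ∧ ¬ n % #(triBdryDarts D.verts) < m) := by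
  unfold frz
  have h3 : ∀ j : Fin 3, j = 0 ∨ j = 1 ∨ j = 2 := by decide
  rcases h3 (D.stretchIdx₃ n) with h | h | h <;> simp [h]

/-! ### the boundary darts of a face share one frame block -/

/-- **the boundary darts of a face**: with `x_j ∈ G ∌ x_{j+1}`, every boundary dart with both endpoints in the face `F` is the dart
`(x_j, x_{j+1})` or its successor. [folklore] [cite: KhristoforovSmirnov2021, §1.2 Lemma 2, proof (arXiv v1 p. 3)] -/
theorem bdryDart_of_face_eq {F : HexVertex} {j : Fin 3} (hj : faceVertex F j ∈ D.verts) (hj1 : faceVertex F (j + 1) ∉ D.verts)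
    {d : Site 2 × Site 2} (hd : d ∈ triBdryDarts D.verts) (h1 : d.1 ∈ hexFaceVertices F) (h2 : d.2 ∈ hexFaceVertices F) :
    d = (faceVertex F j, faceVertex F (j + 1)) ∨ d = triBdrySucc D.verts (faceVertex F j, faceVertex F (j + 1)) := by
  obtain ⟨hu, hv, hadj⟩ := mem_triBdryDarts.1 hd
  obtain ⟨a, ha⟩ := mem_hexFaceVertices_iff_faceVertex.1 h1
  obtain ⟨b, hb⟩ := mem_hexFaceVertices_iff_faceVertex.1 h2
  rw [D.succ_faceDart₃]
  have hab : a ≠ b := fun e => hadj.ne (by rw [ha, hb, e])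
  rcases fin3_cases_z j a with rfl | rfl | rfl
  · rcases fin3_cases_z a b with rfl | rfl | e
    · exact absurd rfl hab
    · exact Or.inl (Prod.ext ha hb)
    · rw [e] at hb
      have h2' : faceVertex F (a + 2) ∉ D.verts := hb ▸ hv
      rw [if_neg h2']
      exact Or.inr (Prod.ext ha hb)
  · exact absurd (ha ▸ hu) hj1
  · have h2' : faceVertex F (j + 2) ∈ D.verts := ha ▸ hu
    rw [if_pos h2']
    rcases fin3_cases_z j b with e | e | e
    · rw [hb, e] at hv; exact absurd hj hv
    · rw [e] at hb; exact Or.inr (Prod.ext ha hb)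
    · exact absurd e.symm hab

/-- **the boundary darts of a face that is neither a corner nor the split face lie in ONE frame block**: same stretch index, same
frame colour, same side of the split. [cite: KhristoforovSmirnov2021, §1.2 Lemma 2, proof (arXiv v1 p. 3)] -/
theorem sameBlock_of_face {m : ℕ} (hm : m ≤ D.pos 1) {F : HexVertex} (hF : F ∈ triFacesTouching D.verts) (hFc : F ∉ corners D)
    (hFs : F ≠ sFace D m) {d₁ d₂ : Site 2 × Site 2} (hd₁ : d₁ ∈ triBdryDarts D.verts) (hd₂ : d₂ ∈ triBdryDarts D.verts)
    (h₁1 : d₁.1 ∈ hexFaceVertices F) (h₁2 : d₁.2 ∈ hexFaceVertices F) (h₂1 : d₂.1 ∈ hexFaceVertices F) (h₂2 : d₂.2 ∈ hexFaceVertices F) :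
    D.stretchIdx₃ (D.dpos d₁) = D.stretchIdx₃ (D.dpos d₂) ∧ frz D m (D.dpos d₁) = frz D m (D.dpos d₂) ∧
      (D.dpos d₁ < m ↔ D.dpos d₂ < m) := by
  have hmL : m < #(triBdryDarts D.verts) := lt_of_le_of_lt hm (pos_facts.2.2.1.trans pos_facts.2.2.2)
  -- the anticlockwise dart of the face and its successor
  obtain ⟨w, hw⟩ := mem_hexFaceVertices_iff_faceVertex.1 h₁2
  obtain ⟨j, hj, hj1⟩ := exists_inner_outer hF (w := w) (hw ▸ (mem_triBdryDarts.1 hd₁).2.1)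
  obtain ⟨hd, hlf, -⟩ := faceDart_facts (D := D) hj hj1
  set d := (faceVertex F j, faceVertex F (j + 1)) with hdd
  set n := D.dpos d with hn
  have hnL : n < #(triBdryDarts D.verts) := D.dpos_lt hd
  have hmark : ∀ i : Fin 3, (n + 1) % #(triBdryDarts D.verts) ≠ D.pos i := by
    intro i hi
    exact hFc ((h1_mem_corners_iff D F).1 ((succ_eq_pos_iff_corner hj hj1).1 ⟨i, hi⟩))
  have hz : (n + 1) % #(triBdryDarts D.verts) ≠ m := by
    intro h
    exact hFs (hlf.symm.trans ((leftFace_eq_sFace_iff hmL hd).2 h))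
  obtain ⟨hs, hf, hlt⟩ := frame_succ_of_not_change (m := m) hmark hz
  have hsucc : D.dpos (triBdrySucc D.verts d) = (n + 1) % #(triBdryDarts D.verts) := D.dpos_succ hd
  -- the facts for the pair (d, succ d)
  have key : ∀ d' : Site 2 × Site 2, d' = d ∨ d' = triBdrySucc D.verts d →
      D.stretchIdx₃ (D.dpos d') = D.stretchIdx₃ n ∧ frz D m (D.dpos d') = frz D m n ∧ (D.dpos d' < m ↔ n < m) := by
    rintro d' (rfl | rfl)
    · exact ⟨rfl, rfl, Iff.rfl⟩
    · rw [hsucc, D.stretchIdx_mod₃, frz_mod, hs, hf, Nat.mod_eq_of_lt hnL] at *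
      exact ⟨rfl, rfl, hlt.symm⟩
  obtain ⟨a1, a2, a3⟩ := key d₁ (bdryDart_of_face_eq hj hj1 hd₁ h₁1 h₁2)
  obtain ⟨b1, b2, b3⟩ := key d₂ (bdryDart_of_face_eq hj hj1 hd₂ h₂1 h₂2)
  exact ⟨a1.trans b1.symm, a2.trans b2.symm, a3.trans b3.symm⟩

/-! ### (A) the class `[z ↔ y₁]` forces a blue crossing `∂_{y₀ z} ↔ A₁`: propagation along the strand -/

section Blue

variable {g o : Site 2} (hg : g ∈ D.verts) (ho : o ∉ D.verts) (hadj : triGraph.Adj g o) (hst : D.stretchIdx₃ (D.dpos (g, o)) = 0)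

/-- `x` (a blue site of `G`) is joined to `∂_{y₀ z}` by blue sites of `G`. [cite: KhristoforovSmirnov2021, §1.1 (arXiv v1 p. 2)] -/
def BConn (D : TriMarkedDomain 3) (g o : Site 2) (T : Finset (Site 2)) (x : Site 2) : Prop :=
  ∃ a ∈ arcTo D g o, PathIn triGraph ((D.verts : Set (Site 2)) ∩ (↑T : Set (Site 2))) a x

/-- **the blue invariant of a bond `{a, c}`**: its blue endpoint is joined to `∂_{y₀ z}` if it is a site of `G`, and is not read through
an `A₁`-dart if it is an outer cell. [cite: KhristoforovSmirnov2021, §1.2 Lemma 2, proof (arXiv v1 p. 3)] -/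
def OKb (D : TriMarkedDomain 3) (g o : Site 2) (T : Finset (Site 2)) (a c : Site 2) : Prop :=
  (a ∈ D.verts → a ∈ T → BConn D g o T a) ∧ (c ∈ D.verts → c ∈ T → BConn D g o T c) ∧
    (a ∈ D.verts → c ∉ D.verts → frz D (mOf D g o T) (D.dpos (a, c)) = true → D.stretchIdx₃ (D.dpos (a, c)) ≠ 1) ∧
    (c ∈ D.verts → a ∉ D.verts → frz D (mOf D g o T) (D.dpos (c, a)) = true → D.stretchIdx₃ (D.dpos (c, a)) ≠ 1)

/-- `OKb` is symmetric. [folklore] [cite: KhristoforovSmirnov2021, §1.2 Lemma 2, proof (arXiv v1 p. 3)] -/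
theorem okb_symm {T : Finset (Site 2)} {a c : Site 2} (h : OKb D g o T a c) : OKb D g o T c a :=
  ⟨h.2.1, h.1, h.2.2.2, h.2.2.1⟩

/-- blue connection passes to a blue neighbour in `G`. [folklore] [cite: KhristoforovSmirnov2021, §1.2 Lemma 2, proof (arXiv v1 p. 3)] -/
theorem bconn_of_adj {T : Finset (Site 2)} {x y : Site 2} (h : BConn D g o T x) (hxy : triGraph.Adj x y) (hy : y ∈ D.verts) (hyT : y ∈ T) :
    BConn D g o T y := by
  obtain ⟨a, ha, hP⟩ := h
  exact ⟨a, ha, hP.tail hxy ⟨Finset.mem_coe.2 hy, Finset.mem_coe.2 hyT⟩⟩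

/-- a blue site of `∂_{y₀ z}` is blue-connected. [folklore] [cite: KhristoforovSmirnov2021, §1.2 Lemma 2, proof (arXiv v1 p. 3)] -/
theorem bconn_of_mem_arcTo {T : Finset (Site 2)} {x : Site 2} (hx : x ∈ arcTo D g o) (hxG : x ∈ D.verts) (hxT : x ∈ T) :
    BConn D g o T x := ⟨x, hx, PathIn.refl ⟨Finset.mem_coe.2 hxG, Finset.mem_coe.2 hxT⟩⟩

/-- a blue-connected site of `A₁` gives the blue crossing. [folklore] [cite: KhristoforovSmirnov2021, §1.2 Lemma 2, proof (arXiv v1 p. 3)] -/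
theorem blueCross_of_bconn {T : Finset (Site 2)} {x : Site 2} (h : BConn D g o T x) (hx : x ∈ D.arc 1) : BlueCross D g o T := by
  obtain ⟨a, ha, hP⟩ := h
  exact ⟨a, ha, x, hx, hP⟩

include hg ho hadj hst

omit hg ho hadj hst in
/-- the split position is `p` or `p + 1`, in particular `≤ p + 1` and `≥ p`. [folklore] [cite: KhristoforovSmirnov2021, §1.2 Lemma 2, proof (arXiv v1 p. 3)] -/
theorem mOf_bounds (T : Finset (Site 2)) : D.dpos (g, o) ≤ mOf D g o T ∧ mOf D g o T ≤ D.dpos (g, o) + 1 := by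
  unfold mOf; split_ifs <;> omega

/-- ★ **STEP of the blue propagation** inside a face `F` (not a corner, not the split face) crossed by the strand through the sides
`{a, b}` and `{b, c}`: the invariant passes from `{a, b}` to `{b, c}`, or the blue crossing is found. [cite: KhristoforovSmirnov2021, §1.2 Lemma 2, proof (arXiv v1 p. 3)] -/
theorem okb_step (T : Finset (Site 2)) {F : HexVertex} (hF : F ∈ triFacesTouching D.verts) (hFc : F ∉ corners D)
    (hFs : F ≠ sOf D g o T) {a b c : Site 2} (haF : a ∈ hexFaceVertices F) (hbF : b ∈ hexFaceVertices F)
    (hcF : c ∈ hexFaceVertices F) (hab' : a ≠ b) (hbc' : b ≠ c) (hac' : a ≠ c)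
    (hab : s(a, b) ∈ Phi D g o T) (hbc : s(b, c) ∈ Phi D g o T) (hok : OKb D g o T a b) :
    BlueCross D g o T ∨ OKb D g o T b c := by
  by_cases hgoal : BlueCross D g o T
  · exact Or.inl hgoal
  right
  set m := mOf D g o T with hmdef
  have hm : m ≤ D.pos 1 := mOf_le hg ho hadj hst T
  have hmb := mOf_bounds (D := D) (g := g) (o := o) T
  have adj_ab : triGraph.Adj a b := adj_of_mem_hexFaceVertices haF hbF hab'
  have adj_bc : triGraph.Adj b c := adj_of_mem_hexFaceVertices hbF hcF hbc'
  have adj_ac : triGraph.Adj a c := adj_of_mem_hexFaceVertices haF hcF hac'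
  have hblock : ∀ {d₁ d₂ : Site 2 × Site 2}, d₁ ∈ triBdryDarts D.verts → d₂ ∈ triBdryDarts D.verts →
      d₁.1 ∈ hexFaceVertices F → d₁.2 ∈ hexFaceVertices F → d₂.1 ∈ hexFaceVertices F → d₂.2 ∈ hexFaceVertices F →
      D.stretchIdx₃ (D.dpos d₁) = D.stretchIdx₃ (D.dpos d₂) ∧ frz D m (D.dpos d₁) = frz D m (D.dpos d₂) ∧
        (D.dpos d₁ < m ↔ D.dpos d₂ < m) :=
    fun hd₁ hd₂ h11 h12 h21 h22 => sameBlock_of_face hm hF hFc hFs hd₁ hd₂ h11 h12 h21 h22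
  obtain ⟨hokA, hokB, hokAo, hokBo⟩ := hok
  unfold Phi at hab hbc
  rw [← hmdef] at hab hbc
  by_cases hbG : b ∈ D.verts
  · by_cases hbT : b ∈ T
    · -- b blue
      have hcb : BConn D g o T b := hokB hbG hbT
      refine ⟨hokB, fun hcG hcT => bconn_of_adj hcb adj_bc hcG hcT, fun _ hcG hf => ?_, fun _ h => absurd hbG h⟩
      rw [mk_mem_phiZ_iff_of_mem_not_mem m T adj_bc hbG hcG] at hbc
      rw [hbc.1 hbT] at hf; exact absurd hf (by decide)
    · -- b yellow: a is blue
      refine ⟨fun _ h => absurd h hbT, fun hcG hcT => ?_, fun _ hcG hf => ?_, fun _ h => absurd hbG h⟩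
      · -- c inner blue: connect it
        by_cases haG : a ∈ D.verts
        · have haT : a ∈ T := by
            rw [mk_mem_phiZ_iff_of_mem_mem m T adj_ab haG hbG] at hab
            by_contra h; exact hbT (by tauto)
          exact bconn_of_adj (hokA haG haT) adj_ac hcG hcT
        · -- a outer, read blue through (b, a): an A₀-dart before the split; so is (c, a)
          rw [Sym2.eq_swap, mk_mem_phiZ_iff_of_mem_not_mem m T adj_ab.symm hbG haG] at hab
          have hfa : frz D m (D.dpos (b, a)) = true := by
            cases h : frz D m (D.dpos (b, a))
            · exact absurd (hab.2 h) hbT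
            · rfl
          have hs1 := hokBo hbG haG hfa
          have hdba : (b, a) ∈ triBdryDarts D.verts := mem_triBdryDarts.2 ⟨hbG, haG, adj_ab.symm⟩
          have hdca : (c, a) ∈ triBdryDarts D.verts := mem_triBdryDarts.2 ⟨hcG, haG, adj_ac.symm⟩
          obtain ⟨e1, -, e3⟩ := hblock hdba hdca hbF haF hcF haF
          rcases (frz_eq_true_iff m _).1 hfa with h1 | ⟨h0, hlt⟩
          · exact absurd h1 hs1
          · rw [Nat.mod_eq_of_lt (D.dpos_lt hdba)] at hlt
            have hca : D.dpos (c, a) ≤ D.dpos (g, o) := by have := e3.1 hlt; omega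
            exact bconn_of_mem_arcTo (fst_mem_arcTo hdca hca) hcG hcT
      · -- c outer read blue through (b, c): not an A₁-dart
        by_cases haG : a ∈ D.verts
        · have haT : a ∈ T := by
            rw [mk_mem_phiZ_iff_of_mem_mem m T adj_ab haG hbG] at hab
            by_contra h; exact hbT (by tauto)
          intro hs1
          have hdbc : (b, c) ∈ triBdryDarts D.verts := mem_triBdryDarts.2 ⟨hbG, hcG, adj_bc⟩
          have hdac : (a, c) ∈ triBdryDarts D.verts := mem_triBdryDarts.2 ⟨haG, hcG, adj_ac⟩
          obtain ⟨e1, -, -⟩ := hblock hdbc hdac hbF hcF haF hcF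
          have ha1 : a ∈ D.arc 1 := by
            have := fst_mem_arc_stretchIdx hdac; rwa [← e1, hs1] at this
          exact hgoal (blueCross_of_bconn (hokA haG haT) ha1)
        · rw [Sym2.eq_swap, mk_mem_phiZ_iff_of_mem_not_mem m T adj_ab.symm hbG haG] at hab
          have hfa : frz D m (D.dpos (b, a)) = true := by
            cases h : frz D m (D.dpos (b, a))
            · exact absurd (hab.2 h) hbT
            · rfl
          have hs1 := hokBo hbG haG hfa
          have hdba : (b, a) ∈ triBdryDarts D.verts := mem_triBdryDarts.2 ⟨hbG, haG, adj_ab.symm⟩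
          have hdbc : (b, c) ∈ triBdryDarts D.verts := mem_triBdryDarts.2 ⟨hbG, hcG, adj_bc⟩
          obtain ⟨e1, -, -⟩ := hblock hdba hdbc hbF haF hbF hcF
          rw [← e1]; exact hs1
  · -- b outer: a and c are sites of G reading b through the same block
    have haG : a ∈ D.verts := by
      obtain ⟨x, y, hxy, hx, -⟩ := exists_rep_of_mem_hBonds D (phiZ_subset m T hab)
      rcases Sym2.eq_iff.1 hxy with ⟨e1, -⟩ | ⟨-, e2⟩
      · exact e1 ▸ hx
      · exact absurd (e2 ▸ hx) hbG
    have hcG : c ∈ D.verts := by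
      obtain ⟨x, y, hxy, hx, -⟩ := exists_rep_of_mem_hBonds D (phiZ_subset m T hbc)
      rcases Sym2.eq_iff.1 hxy with ⟨e1, -⟩ | ⟨-, e2⟩
      · exact absurd (e1 ▸ hx) hbG
      · exact e2 ▸ hx
    have hdab : (a, b) ∈ triBdryDarts D.verts := mem_triBdryDarts.2 ⟨haG, hbG, adj_ab⟩
    have hdcb : (c, b) ∈ triBdryDarts D.verts := mem_triBdryDarts.2 ⟨hcG, hbG, adj_bc.symm⟩
    obtain ⟨e1, e2, -⟩ := hblock hdab hdcb haF hbF hcF hbF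
    rw [mk_mem_phiZ_iff_of_mem_not_mem m T adj_ab haG hbG] at hab
    rw [Sym2.eq_swap, mk_mem_phiZ_iff_of_mem_not_mem m T adj_bc.symm hcG hbG] at hbc
    refine ⟨fun h => absurd h hbG, fun _ hcT => ?_, fun h => absurd h hbG, fun _ _ hf => ?_⟩
    · have haT : a ∈ T := hab.2 (e2 ▸ hbc.1 hcT)
      exact bconn_of_adj (hokA haG haT) adj_ac hcG hcT
    · rw [← e1]; exact hokAo haG hbG (e2 ▸ hf)

end Blue

end Crossing

section BlueMain

variable {D : TriMarkedDomain 3}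

/-- **the corner `y_i` is the split face of the split position `pos i`** (the left face of the dart preceding the `i`-th mark).
[cite: KhristoforovSmirnov2021, §1.2 (loop configurations, arXiv v1 pp. 2–3)] -/
theorem sFace_pos_eq_yc (i : Fin 3) : sFace D (D.pos i) = yc D i := by
  have hpd : bdart D (D.pos i + (#(triBdryDarts D.verts) - 1)) = predDart D i := rfl
  apply eq_yc
  unfold IsCornerFace sFace
  rw [hpd]
  obtain ⟨hu, hv, hadj⟩ := mem_triBdryDarts.1 (predDart_mem D i)
  rw [hexFaceVertices_leftFace hadj, predDart_fst]
  have key := succ_predDart D i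
  unfold triBdrySucc at key
  split_ifs at key with hw
  · exfalso
    have e1 : triLeftApex (predDart D i).1 (predDart D i).2 = D.markSite i := congrArg Prod.fst key
    rw [← predDart_fst D i] at e1
    exact (triGraph_adj_triLeftApex_left hadj).ne e1.symm
  · have e2 : triLeftApex (predDart D i).1 (predDart D i).2 = (D.markDart i).2 := congrArg Prod.snd key
    rw [predDart_fst] at e2
    rw [e2, Finset.pair_comm]

/-- the split face is a corner only when the split position is that mark. [cite: KhristoforovSmirnov2021, §1.2 (loop configurations, arXiv v1 pp. 2–3)] -/
theorem eq_pos_of_sFace_eq_yc {m : ℕ} (hm : m < #(triBdryDarts D.verts)) {i : Fin 3} (h : sFace D m = yc D i) : m = D.pos i := by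
  rw [← sFace_pos_eq_yc i] at h
  unfold sFace at h
  have e := eq_of_leftFace_eq (bdart_mem _) (bdart_mem _) h
  have h1 := succ_bdart_pred (D := D) m
  rw [e, succ_bdart_pred] at h1
  have := congrArg D.dpos h1
  rw [dpos_bdart, dpos_bdart, Nat.mod_eq_of_lt (D.pos_lt i), Nat.mod_eq_of_lt hm] at this
  exact this.symm

section B

variable {g o : Site 2} (hg : g ∈ D.verts) (ho : o ∉ D.verts) (hadj : triGraph.Adj g o) (hst : D.stretchIdx₃ (D.dpos (g, o)) = 0)

/-- **the blue face invariant**: every side of `F` lying in `Φ(σ)` satisfies the bond invariant (or the crossing is found).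
[cite: KhristoforovSmirnov2021, §1.2 Lemma 2, proof (arXiv v1 p. 3)] -/
def PFace (D : TriMarkedDomain 3) (g o : Site 2) (T : Finset (Site 2)) (F : HexVertex) : Prop :=
  BlueCross D g o T ∨ ∀ j : Fin 3, side F j ∈ Phi D g o T → OKb D g o T (faceVertex F (j + 1)) (faceVertex F (j + 2))

/-- reading the invariant of a side given by its endpoints. [folklore] [cite: KhristoforovSmirnov2021, §1.2 Lemma 2, proof (arXiv v1 p. 3)] -/
theorem okb_of_pface {T : Finset (Site 2)} {F : HexVertex} (hP : PFace D g o T F) (hgoal : ¬ BlueCross D g o T) {j : Fin 3} {u w : Site 2}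
    (hj : side F j ∈ Phi D g o T) (he : side F j = s(u, w)) : OKb D g o T u w := by
  rcases hP with h | h
  · exact absurd h hgoal
  · have hok := h j hj
    unfold side at he
    rcases Sym2.eq_iff.1 he with ⟨e1, e2⟩ | ⟨e1, e2⟩
    · rw [e1, e2] at hok; exact hok
    · rw [e1, e2] at hok; exact okb_symm hok

include hg ho hadj hst

omit hst in
/-- when `z` is the last mid-edge of `A₀` and `g` is blue, the crossing is trivial (`g = v₁ ∈ A₀ ∩ A₁`). [cite: KhristoforovSmirnov2021, §2 eq. (4) (arXiv v1 p. 5)] -/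
theorem blueCross_of_last {T : Finset (Site 2)} (hgT : g ∈ T) (hp : D.dpos (g, o) + 1 = D.pos 1) : BlueCross D g o T := by
  have hd := zdart_mem hg ho hadj
  have hL : D.pos 1 < #(triBdryDarts D.verts) := pos_facts.2.2.1.trans pos_facts.2.2.2
  have h1 : (D.dpos (g, o) + 1) % #(triBdryDarts D.verts) = D.pos 1 := by rw [hp, Nat.mod_eq_of_lt hL]
  have e : (g, o) = predDart D 1 := by
    have := iter_eq_predDart (D := D) h1
    rwa [D.iter_dpos hd] at this
  have hg1 : g ∈ D.arc 1 := by
    have : g = D.markSite 1 := by rw [← predDart_fst D 1, ← e]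
    rw [this]; exact D.markSite_mem_arc 1
  exact ⟨g, fst_mem_arcTo hd le_rfl, g, hg1, PathIn.refl ⟨Finset.mem_coe.2 hg, Finset.mem_coe.2 hgT⟩⟩

/-- ★ **BASE of the blue propagation**: the invariant holds at the odd endpoint `sOf σ` (the disorder at `z`).
[cite: KhristoforovSmirnov2021, §1.2 Lemma 2, proof (arXiv v1 p. 3)] -/
theorem pface_sOf (T : Finset (Site 2)) : PFace D g o T (sOf D g o T) := by
  classical
  by_cases hgoal : BlueCross D g o T
  · exact Or.inl hgoal
  have hd := zdart_mem hg ho hadj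
  have hpL := D.dpos_lt hd
  have hp1 := zpos_lt_pos_one hg ho hadj hst
  obtain ⟨h00, h01, h12, h2L⟩ := pos_facts (D := D)
  set m := mOf D g o T with hmdef
  set p := D.dpos (g, o) with hpdef
  -- the dart `d` of the split face and its successor
  set d := bdart D (m + (#(triBdryDarts D.verts) - 1)) with hdd
  have hdm : d ∈ triBdryDarts D.verts := bdart_mem _
  obtain ⟨hd1, hd2, hdadj⟩ := mem_triBdryDarts.1 hdm
  have hsucc : triBdrySucc D.verts d = bdart D m := succ_bdart_pred m
  have hsF : sOf D g o T = leftFace d.1 d.2 := rfl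
  have hverts : hexFaceVertices (sOf D g o T) = {d.1, d.2, triLeftApex d.1 d.2} := by rw [hsF, hexFaceVertices_leftFace hdadj]
  -- `m < pos 1` (else the crossing is trivial)
  have hmlt : m < D.pos 1 := by
    rcases (mOf_le hg ho hadj hst T).lt_or_eq with h | h
    · exact h
    · exfalso
      have hgT : g ∈ T := by
        by_contra hgT
        have : m = p := by rw [hmdef]; unfold mOf; rw [if_neg hgT]
        omega
      have : m = p + 1 := by rw [hmdef]; unfold mOf; rw [if_pos hgT]
      exact hgoal (blueCross_of_last hg ho hadj hgT (by omega))
  -- in the case `g ∈ T`: `d = (g, o)`; in the case `g ∉ T`: `succ d = (g, o)`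
  have hcase : (g ∈ T ∧ m = p + 1 ∧ d = (g, o)) ∨ (g ∉ T ∧ m = p ∧ triBdrySucc D.verts d = (g, o)) := by
    by_cases hgT : g ∈ T
    · have hm1 : m = p + 1 := by rw [hmdef]; unfold mOf; rw [if_pos hgT]
      refine Or.inl ⟨hgT, hm1, ?_⟩
      rw [hdd, hm1, show p + 1 + (#(triBdryDarts D.verts) - 1) = p + #(triBdryDarts D.verts) by omega]
      unfold bdart; rw [D.isTriDisc.iter_add_card, hpdef, D.iter_dpos hd]
    · have hm0 : m = p := by rw [hmdef]; unfold mOf; rw [if_neg hgT]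
      refine Or.inr ⟨hgT, hm0, ?_⟩
      rw [hsucc, hm0, hpdef, bdart_dpos hd]
  -- (1) inner blue vertices of the split face are blue-connected
  have hconn : ∀ x ∈ hexFaceVertices (sOf D g o T), x ∈ D.verts → x ∈ T → BConn D g o T x := by
    intro x hx hxG hxT
    rw [hverts, Finset.mem_insert, Finset.mem_insert, Finset.mem_singleton] at hx
    -- the tail d.1
    have htail : d.1 ∈ T → BConn D g o T d.1 := by
      intro h1T
      rcases hcase with ⟨hgT, hm1, hdg⟩ | ⟨hgT, hm0, hsg⟩
      · rw [hdg]; exact bconn_of_mem_arcTo (fst_mem_arcTo hd le_rfl) hg hgT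
      · by_cases hp0 : p = 0
        · -- `d = predDart 0`, whose tail is the marked site `v₀ = g`
          exfalso
          have hdp : d = predDart D 0 := by
            rw [hdd, hm0, hp0]
            show bdart D (0 + (#(triBdryDarts D.verts) - 1)) = triBdryIter D.verts D.base (D.pos 0 + (D.bdryLen - 1))
            rw [h00]; rfl
          have e1 : d.1 = g := by
            have h1 := congrArg Prod.fst hsg
            rw [hdp, succ_predDart] at h1
            rw [hdp, predDart_fst]; exact h1
          exact hgT (e1 ▸ h1T)
        · have hpos : D.dpos d ≤ p := by
            rw [hdd, dpos_bdart, hm0, show p + (#(triBdryDarts D.verts) - 1) = (p - 1) + #(triBdryDarts D.verts) by omega,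
              Nat.add_mod_right, Nat.mod_eq_of_lt (by omega)]
            omega
          exact bconn_of_mem_arcTo (fst_mem_arcTo hdm hpos) hd1 h1T
    rcases hx with rfl | rfl | rfl
    · exact htail hxT
    · exact absurd hxG hd2
    · -- the apex
      rcases hcase with ⟨hgT, hm1, hdg⟩ | ⟨hgT, hm0, hsg⟩
      · have hgc : BConn D g o T g := bconn_of_mem_arcTo (fst_mem_arcTo hd le_rfl) hg hgT
        have : d.1 = g := by rw [hdg]
        exact bconn_of_adj hgc (this ▸ triGraph_adj_triLeftApex_left hdadj) hxG hxT
      · exfalso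
        unfold triBdrySucc at hsg
        rw [if_pos hxG] at hsg
        have : triLeftApex d.1 d.2 = g := congrArg Prod.fst hsg
        exact hgT (this ▸ hxT)
  -- (2) no dart of the split face is read as a blue `A₁`-dart
  have hdarts : ∀ a c : Site 2, a ∈ D.verts → c ∉ D.verts → triGraph.Adj a c → a ∈ hexFaceVertices (sOf D g o T) →
      c ∈ hexFaceVertices (sOf D g o T) → frz D m (D.dpos (a, c)) = true → D.stretchIdx₃ (D.dpos (a, c)) ≠ 1 := by
    intro a c haG hcG hac h1 h2 hf
    have hd' : (a, c) ∈ triBdryDarts D.verts := mem_triBdryDarts.2 ⟨haG, hcG, hac⟩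
    obtain ⟨j, hj, hj1⟩ := exists_eq_faceVertex_of_adj hdadj
    rw [hsF] at h1 h2
    have hdj : d = (faceVertex (leftFace d.1 d.2) j, faceVertex (leftFace d.1 d.2) (j + 1)) := Prod.ext hj hj1
    rcases bdryDart_of_face_eq (D := D) (hj ▸ hd1) (hj1 ▸ hd2) hd' h1 h2 with e | e
    · -- the dart `d`: position m - 1 (stretch 0) or L - 1 (stretch 2)
      rw [← hdj] at e
      rw [e, dpos_bdart]
      by_cases hm0 : m = 0
      · rw [hm0, Nat.zero_add, Nat.mod_eq_of_lt (by omega)]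
        have : D.stretchIdx₃ (#(triBdryDarts D.verts) - 1) = 2 := D.stretchIdx_last₃
        rw [this]; decide
      · rw [show m + (#(triBdryDarts D.verts) - 1) = (m - 1) + #(triBdryDarts D.verts) by omega, Nat.add_mod_right,
          Nat.mod_eq_of_lt (by omega)]
        rw [stretchIdx_zero_of_lt (by rw [Nat.mod_eq_of_lt (by omega)]; omega)]; decide
    · -- the dart `succ d = bdart m`: yellow
      rw [← hdj, hsucc] at e
      rw [e, dpos_bdart, Nat.mod_eq_of_lt (by omega), frz_of_stretchIdx_zero (stretchIdx_zero_of_lt (by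
        rw [Nat.mod_eq_of_lt (by omega)]; exact hmlt)), Nat.mod_eq_of_lt (by omega)] at hf
      simp at hf
  -- conclusion
  right
  intro j hj
  have hv1 := faceVertex_mem (sOf D g o T) (j + 1)
  have hv2 := faceVertex_mem (sOf D g o T) (j + 2)
  have hne : faceVertex (sOf D g o T) (j + 1) ≠ faceVertex (sOf D g o T) (j + 2) :=
    fun e => fin3_ne_add_one (j + 1) (by rw [fin3_add_one_add_one]; exact faceVertex_injective _ e)
  have hadj12 := adj_of_mem_hexFaceVertices hv1 hv2 hne
  unfold OKb
  refine ⟨?_, ?_, ?_, ?_⟩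
  · intro h1 h2; exact hconn _ hv1 h1 h2
  · intro h1 h2; exact hconn _ hv2 h1 h2
  · intro h1 h2 hf
    rw [← hmdef] at hf
    exact hdarts _ _ h1 h2 hadj12 hv1 hv2 hf
  · intro h1 h2 hf
    rw [← hmdef] at hf
    exact hdarts _ _ h1 h2 hadj12.symm hv2 hv1 hf

/-- ★ **END of the blue propagation**: if the invariant reaches the corner `y₁ ≠ sOf σ`, the blue crossing exists (`y₁` has a side in
`Φ(σ)`: across the dart before the mark `v₁` is blue and joined to `∂_{y₀ z}`; across the marked dart the outer cell would be a blue
`A₁`-cell, excluded by the invariant). [cite: KhristoforovSmirnov2021, §1.2 Lemma 2, proof (arXiv v1 p. 3)] -/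
theorem blueCross_of_pface_yc_one {v : HexVertex} {i : Fin 3} (he : side v i = s(g, o)) (T : Finset (Site 2))
    (hP : PFace D g o T (yc D 1)) (hne : yc D 1 ≠ sOf D g o T) : BlueCross D g o T := by
  classical
  by_contra hgoal
  obtain ⟨h00, h01, h12, h2L⟩ := pos_facts (D := D)
  set m := mOf D g o T with hmdef
  have hm : m ≤ D.pos 1 := mOf_le hg ho hadj hst T
  have hmL : m < #(triBdryDarts D.verts) := by omega
  have hm1 : m ≠ D.pos 1 := fun e => hne (by rw [← sFace_pos_eq_yc 1, ← e]; rfl)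
  -- y₁ is odd in Φ(σ), so it has a side in it
  have hξ := Phi_mem_TXb hg ho hadj hst he T
  rw [mem_TXb_iff] at hξ
  have hodd : Odd (xiDeg (Phi D g o T) (yc D 1)) := (hξ.2 _ (yc_mem_touching D 1)).2 (by
    rw [Finset.mem_symmDiff, Finset.mem_singleton]; exact Or.inl ⟨yc_mem_corners D 1, hne⟩)
  obtain ⟨j, hj⟩ : ∃ j : Fin 3, side (yc D 1) j ∈ Phi D g o T := by
    by_contra hno
    push Not at hno
    rw [l1_xiDeg_eq, Finset.filter_eq_empty_iff.2 (fun j _ => hno j), Finset.card_empty] at hodd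
    exact absurd hodd (by decide)
  -- the corner y₁: v₁ = x_w, the other two vertices outer
  obtain ⟨w, hw, hw1, hw2, hor⟩ := isCornerFace_typeII D (yc_spec D 1)
  have hv1G : faceVertex (yc D 1) w ∈ D.verts := hw ▸ markSite_mem D 1
  -- the side is {v₁, x_{w+1}} or {v₁, x_{w+2}}
  obtain ⟨s2, s1, s0⟩ := sides_from (yc D 1) w
  have hside : side (yc D 1) j = s(faceVertex (yc D 1) w, faceVertex (yc D 1) (w + 1)) ∨
      side (yc D 1) j = s(faceVertex (yc D 1) w, faceVertex (yc D 1) (w + 2)) := by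
    rcases fin3_cases_z w j with rfl | rfl | rfl
    · exfalso
      rw [s0] at hj
      obtain ⟨a, b, hab, ha, -⟩ := exists_rep_of_mem_hBonds D (phiZ_subset _ T hj)
      rcases Sym2.eq_iff.1 hab with ⟨e1, -⟩ | ⟨-, e2⟩
      · exact hw1 (e1 ▸ ha)
      · exact hw2 (e2 ▸ ha)
    · exact Or.inr (by rw [s1, Sym2.eq_swap])
    · exact Or.inl s2
  -- positions of the two darts at v₁
  have hpd : D.dpos (predDart D 1) = D.pos 1 - 1 := by
    have h := dpos_predDart_succ D 1
    have hlt := D.dpos_lt (predDart_mem D 1)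
    by_cases hc : D.dpos (predDart D 1) + 1 < #(triBdryDarts D.verts)
    · rw [Nat.mod_eq_of_lt hc] at h; omega
    · rw [show D.dpos (predDart D 1) + 1 = #(triBdryDarts D.verts) by omega, Nat.mod_self] at h; omega
  have hfr_pred : frz D m (D.dpos (predDart D 1)) = false := by
    rw [hpd, frz_of_stretchIdx_zero (stretchIdx_zero_of_lt (by rw [Nat.mod_eq_of_lt (by omega)]; omega)),
      Nat.mod_eq_of_lt (by omega)]
    have : ¬ (D.pos 1 - 1 < m) := by omega
    simp [this]
  have hfr_mark : frz D m (D.dpos (D.markDart 1)) = true := by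
    rw [dpos_markDart]; exact frz_of_stretchIdx_one (by rw [← dpos_markDart D 1]; exact stretchIdx₃_markDart 1)
  have hs_mark : D.stretchIdx₃ (D.dpos (D.markDart 1)) = 1 := stretchIdx₃_markDart 1
  -- the two darts as vertex pairs
  have key : ∀ {u : Site 2}, u ∉ D.verts → (u = (predDart D 1).2 ∨ u = (D.markDart 1).2) →
      side (yc D 1) j = s(faceVertex (yc D 1) w, u) → s(faceVertex (yc D 1) w, u) ∈ Phi D g o T → False := by
    intro u huG hu hsd hmem
    have hok := okb_of_pface hP hgoal hj hsd
    obtain ⟨hokA, -, hokAo, -⟩ := hok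
    have hadj' : triGraph.Adj (faceVertex (yc D 1) w) u := by
      have := phiZ_subset _ T hmem
      obtain ⟨a, b, hab, -, hadj''⟩ := exists_rep_of_mem_hBonds D this
      rcases Sym2.eq_iff.1 hab with ⟨e1, e2⟩ | ⟨e1, e2⟩
      · rw [e1, e2]; exact hadj''
      · rw [e1, e2]; exact hadj''.symm
    unfold Phi at hmem
    rw [← hmdef, mk_mem_phiZ_iff_of_mem_not_mem m T hadj' hv1G huG] at hmem
    rcases hu with rfl | rfl
    · have e : (faceVertex (yc D 1) w, (predDart D 1).2) = predDart D 1 := Prod.ext (by rw [predDart_fst]; exact hw) rfl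
      rw [e] at hmem
      have hvT : faceVertex (yc D 1) w ∈ T := hmem.2 hfr_pred
      exact hgoal (blueCross_of_bconn (hokA hv1G hvT) (hw ▸ D.markSite_mem_arc 1))
    · have e : (faceVertex (yc D 1) w, (D.markDart 1).2) = D.markDart 1 := Prod.ext hw rfl
      rw [e] at hmem hokAo
      exact hokAo hv1G huG hfr_mark hs_mark
  rcases hside with hsd | hsd
  · rcases hor with ⟨e1, -⟩ | ⟨e1, -⟩
    · exact key (e1 ▸ hw1) (Or.inl e1) hsd (hsd ▸ hj)
    · exact key (e1 ▸ hw1) (Or.inr e1) hsd (hsd ▸ hj)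
  · rcases hor with ⟨-, e2⟩ | ⟨-, e2⟩
    · exact key (e2 ▸ hw2) (Or.inr e2) hsd (hsd ▸ hj)
    · exact key (e2 ▸ hw2) (Or.inl e2) hsd (hsd ▸ hj)

/-- **the propagation step between faces**: across a side in `Φ(σ)` the face invariant passes to the next face.
[cite: KhristoforovSmirnov2021, §1.2 Lemma 2, proof (arXiv v1 p. 3)] -/
theorem pface_step {v : HexVertex} (hv : AllSides D v) {i : Fin 3} (he : side v i = s(g, o)) (T : Finset (Site 2)) {F F' : HexVertex}
    (hP : PFace D g o T F) (hFF' : (sideGraph (Phi D g o T)).Adj F F') : PFace D g o T F' := by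
  classical
  by_cases hgoal : BlueCross D g o T
  · exact Or.inl hgoal
  by_cases hFs : F' = sOf D g o T
  · rw [hFs]; exact pface_sOf hg ho hadj hst T
  obtain ⟨j, rfl, hj⟩ := hFF'
  set ξ := Phi D g o T with hξdef
  have hξT := Phi_mem_TXb hg ho hadj hst he T
  have hsub : ξ ⊆ hBonds D := fun b hb => phiZ_subset _ T hb
  set k := oppIdx F j with hk
  set F' := oppFace F j with hF'def
  -- the shared side, seen from F'
  have hshared : side F' k = side F j := side_oppFace_oppIdx F j
  have hjk' : side F' k ∈ ξ := by rw [hshared]; exact hj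
  have hokk : OKb D g o T (faceVertex F' (k + 1)) (faceVertex F' (k + 2)) := by
    have := okb_of_pface hP hgoal hj (rfl : side F j = s(faceVertex F (j + 1), faceVertex F (j + 2)))
    rw [hF'def, hk, faceVertex_oppFace_succ, faceVertex_oppFace_succ_succ]
    exact okb_symm this
  right
  intro j' hj'
  by_cases hjk : j' = k
  · rw [hjk]; exact hokk
  -- two distinct sides of F' in ξ: F' is even, hence not a corner (being ≠ s)
  have hF't : F' ∈ triFacesTouching D.verts := mem_touching_of_side_mem D (hsub hj')
  have hs := sOf_mem_pair hg ho hadj hv he T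
  have hdeg := xiDeg_le_two_of_mem_TXb D i hs hξT F'
  have hge : 2 ≤ xiDeg ξ F' := by
    rw [l1_xiDeg_eq]
    have hsub2 : ({k, j'} : Finset (Fin 3)) ⊆ ((Finset.univ : Finset (Fin 3)).filter fun i => side F' i ∈ ξ) := by
      intro x hx
      rw [Finset.mem_insert, Finset.mem_singleton] at hx
      rw [Finset.mem_filter]
      rcases hx with rfl | rfl
      · exact ⟨Finset.mem_univ _, hjk'⟩
      · exact ⟨Finset.mem_univ _, hj'⟩
    have hc : #({k, j'} : Finset (Fin 3)) = 2 := Finset.card_pair (Ne.symm hjk)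
    calc 2 = #({k, j'} : Finset (Fin 3)) := hc.symm
      _ ≤ _ := Finset.card_le_card hsub2
  have h2 : xiDeg ξ F' = 2 := le_antisymm hdeg hge
  have heven : ¬ Odd (xiDeg ξ F') := by rw [h2]; decide
  have hFc : F' ∉ corners D := by
    intro hc
    have hξT' := hξT
    rw [mem_TXb_iff] at hξT'
    apply heven
    apply (hξT'.2 _ hF't).2
    rw [Finset.mem_symmDiff, Finset.mem_singleton]; exact Or.inl ⟨hc, hFs⟩
  -- vertices of F' from k
  obtain ⟨s2, s1, s0⟩ := sides_from F' k
  have hx0 := faceVertex_mem F' k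
  have hx1 := faceVertex_mem F' (k + 1)
  have hx2 := faceVertex_mem F' (k + 2)
  have n01 : faceVertex F' k ≠ faceVertex F' (k + 1) := fun e => fin3_ne_add_one k (faceVertex_injective _ e)
  have n02 : faceVertex F' k ≠ faceVertex F' (k + 2) := fun e => fin3_ne_add_two k (faceVertex_injective _ e)
  have n12 : faceVertex F' (k + 1) ≠ faceVertex F' (k + 2) :=
    fun e => fin3_add_two_ne_add_one k (faceVertex_injective _ e).symm
  have hab : s(faceVertex F' (k + 1), faceVertex F' (k + 2)) ∈ ξ := by rw [← s0]; exact hjk'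
  rcases fin3_cases_z k j' with e | e | e
  · exact absurd e hjk
  · -- j' = k + 1: the strand leaves through {x_{k+2}, x_k}
    rw [e] at hj' ⊢
    rw [s1] at hj'
    have step := okb_step hg ho hadj hst T hF't hFc hFs hx1 hx2 hx0 n12 (Ne.symm n02) (Ne.symm n01) hab hj' hokk
    rw [fin3_add_one_add_one, fin3_add_one_add_two]
    rcases step with h | h
    · exact absurd h hgoal
    · exact h
  · -- j' = k + 2: the strand leaves through {x_k, x_{k+1}}
    rw [e] at hj' ⊢
    rw [s2] at hj'
    have hba : s(faceVertex F' (k + 2), faceVertex F' (k + 1)) ∈ ξ := by rw [Sym2.eq_swap]; exact hab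
    have hbc : s(faceVertex F' (k + 1), faceVertex F' k) ∈ ξ := by rw [Sym2.eq_swap]; exact hj'
    have step := okb_step hg ho hadj hst T hF't hFc hFs hx2 hx1 hx0 (Ne.symm n12) (Ne.symm n01) (Ne.symm n02) hba hbc
      (okb_symm hokk)
    rw [fin3_add_two_add_one, fin3_add_two_add_two]
    rcases step with h | h
    · exact absurd h hgoal
    · exact okb_symm h

/-- ★ **(A) THE CLASS `[z ↔ y₁]` FORCES THE BLUE CROSSING `∂_{y₀ z} ↔ A₁`**: if the strand of `Φ(σ)` from the disorder at `z` ends at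
the corner `y₁`, then `σ` has a blue path in `G` from the sub-arc `∂_{y₀ z}` to the arc `A₁` (the blue cells on one side of the
interface). [cite: KhristoforovSmirnov2021, §1.2 Lemma 2, proof (arXiv v1 p. 3): «∂_{u₁u₂}Ω ↔ ∂_{u₃u₄}Ω in σ if and only if [u₁u₄|u₂u₃] in ξ(σ)»] -/
theorem blueCross_of_reachable {v : HexVertex} (hv : AllSides D v) {i : Fin 3} (he : side v i = s(g, o)) (T : Finset (Site 2))
    (hR : (sideGraph (Phi D g o T)).Reachable (sOf D g o T) (yc D 1)) : BlueCross D g o T := by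
  classical
  have hP : ∀ F, Relation.ReflTransGen (sideGraph (Phi D g o T)).Adj (sOf D g o T) F → PFace D g o T F := by
    intro F h
    induction h with
    | refl => exact pface_sOf hg ho hadj hst T
    | tail _ hbc ih => exact pface_step hg ho hadj hst hv he T ih hbc
  have hP1 := hP (yc D 1) ((SimpleGraph.reachable_iff_reflTransGen _ _).1 hR)
  by_cases hne : yc D 1 = sOf D g o T
  · -- the split face is `y₁`: `m = pos 1`, i.e. `g = v₁` is blue and `z` is the last mid-edge of `A₀`
    obtain ⟨h00, h01, h12, h2L⟩ := pos_facts (D := D)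
    have hm : mOf D g o T = D.pos 1 :=
      eq_pos_of_sFace_eq_yc (lt_of_le_of_lt (mOf_le hg ho hadj hst T) (by omega)) hne.symm
    have hp1 := zpos_lt_pos_one hg ho hadj hst
    have hgT : g ∈ T := by
      by_contra hgT
      unfold mOf at hm; rw [if_neg hgT] at hm; omega
    unfold mOf at hm; rw [if_pos hgT] at hm
    exact blueCross_of_last hg ho hadj hgT hm
  · exact blueCross_of_pface_yc_one hg ho hadj hst he T hP1 hne

end B

end BlueMain

/-! ### (B) the class `[z ↔ y₀]` forces a yellow crossing `∂_{z y₁} ↔ A₂` (the mirror image of (A)) -/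

section Yellow

variable {D : TriMarkedDomain 3}
variable {g o : Site 2} (hg : g ∈ D.verts) (ho : o ∉ D.verts) (hadj : triGraph.Adj g o) (hst : D.stretchIdx₃ (D.dpos (g, o)) = 0)

/-- `x` (a yellow site of `G`) is joined to `∂_{z y₁}` by yellow sites of `G`. [cite: KhristoforovSmirnov2021, §1.1 (arXiv v1 p. 2)] -/
def YConn (D : TriMarkedDomain 3) (g o : Site 2) (T : Finset (Site 2)) (x : Site 2) : Prop :=
  ∃ a ∈ arcFrom D g o, PathIn triGraph ((D.verts : Set (Site 2)) ∩ (↑T : Set (Site 2))ᶜ) a x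

/-- **the yellow invariant of a bond `{a, c}`**: its yellow endpoint is joined to `∂_{z y₁}` if it is a site of `G`, and is not read
through an `A₂`-dart if it is an outer cell. [cite: KhristoforovSmirnov2021, §1.2 Lemma 2, proof (arXiv v1 p. 3)] -/
def OKy (D : TriMarkedDomain 3) (g o : Site 2) (T : Finset (Site 2)) (a c : Site 2) : Prop :=
  (a ∈ D.verts → a ∉ T → YConn D g o T a) ∧ (c ∈ D.verts → c ∉ T → YConn D g o T c) ∧
    (a ∈ D.verts → c ∉ D.verts → frz D (mOf D g o T) (D.dpos (a, c)) = false → D.stretchIdx₃ (D.dpos (a, c)) ≠ 2) ∧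
    (c ∈ D.verts → a ∉ D.verts → frz D (mOf D g o T) (D.dpos (c, a)) = false → D.stretchIdx₃ (D.dpos (c, a)) ≠ 2)

/-- `OKy` is symmetric. [folklore] [cite: KhristoforovSmirnov2021, §1.2 Lemma 2, proof (arXiv v1 p. 3)] -/
theorem oky_symm {T : Finset (Site 2)} {a c : Site 2} (h : OKy D g o T a c) : OKy D g o T c a :=
  ⟨h.2.1, h.1, h.2.2.2, h.2.2.1⟩

/-- yellow connection passes to a yellow neighbour in `G`. [folklore] [cite: KhristoforovSmirnov2021, §1.2 Lemma 2, proof (arXiv v1 p. 3)] -/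
theorem yconn_of_adj {T : Finset (Site 2)} {x y : Site 2} (h : YConn D g o T x) (hxy : triGraph.Adj x y) (hy : y ∈ D.verts) (hyT : y ∉ T) :
    YConn D g o T y := by
  obtain ⟨a, ha, hP⟩ := h
  exact ⟨a, ha, hP.tail hxy ⟨Finset.mem_coe.2 hy, fun h => hyT (Finset.mem_coe.1 h)⟩⟩

/-- a yellow site of `∂_{z y₁}` is yellow-connected. [folklore] [cite: KhristoforovSmirnov2021, §1.2 Lemma 2, proof (arXiv v1 p. 3)] -/
theorem yconn_of_mem_arcFrom {T : Finset (Site 2)} {x : Site 2} (hx : x ∈ arcFrom D g o) (hxG : x ∈ D.verts) (hxT : x ∉ T) :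
    YConn D g o T x := ⟨x, hx, PathIn.refl ⟨Finset.mem_coe.2 hxG, fun h => hxT (Finset.mem_coe.1 h)⟩⟩

/-- a yellow-connected site of `A₂` gives the yellow crossing. [folklore] [cite: KhristoforovSmirnov2021, §1.2 Lemma 2, proof (arXiv v1 p. 3)] -/
theorem yellowCross_of_yconn {T : Finset (Site 2)} {x : Site 2} (h : YConn D g o T x) (hx : x ∈ D.arc 2) : YellowCross D g o T := by
  obtain ⟨a, ha, hP⟩ := h
  exact ⟨a, ha, x, hx, hP⟩

/-- the marked site `v_i` lies on the arc before it. [cite: BollobasRiordan2006, Ch. 7 §7.2.2 (p. 193): «We include both vᵢ and v_{i+1} into Aᵢ»] -/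
theorem markSite_mem_arc_sub_one (i : Fin 3) : D.markSite i ∈ D.arc (i - 1) := by
  have := fst_mem_arc_stretchIdx (D := D) (predDart_mem D i)
  rwa [stretchIdx₃_predDart, predDart_fst] at this

include hg ho hadj hst

/-- ★ **STEP of the yellow propagation** inside a face crossed by the strand. [cite: KhristoforovSmirnov2021, §1.2 Lemma 2, proof (arXiv v1 p. 3)] -/
theorem oky_step (T : Finset (Site 2)) {F : HexVertex} (hF : F ∈ triFacesTouching D.verts) (hFc : F ∉ corners D)
    (hFs : F ≠ sOf D g o T) {a b c : Site 2} (haF : a ∈ hexFaceVertices F) (hbF : b ∈ hexFaceVertices F)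
    (hcF : c ∈ hexFaceVertices F) (hab' : a ≠ b) (hbc' : b ≠ c) (hac' : a ≠ c)
    (hab : s(a, b) ∈ Phi D g o T) (hbc : s(b, c) ∈ Phi D g o T) (hok : OKy D g o T a b) :
    YellowCross D g o T ∨ OKy D g o T b c := by
  by_cases hgoal : YellowCross D g o T
  · exact Or.inl hgoal
  right
  set m := mOf D g o T with hmdef
  have hm : m ≤ D.pos 1 := mOf_le hg ho hadj hst T
  have hmb := mOf_bounds (D := D) (g := g) (o := o) T
  have adj_ab : triGraph.Adj a b := adj_of_mem_hexFaceVertices haF hbF hab'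
  have adj_bc : triGraph.Adj b c := adj_of_mem_hexFaceVertices hbF hcF hbc'
  have adj_ac : triGraph.Adj a c := adj_of_mem_hexFaceVertices haF hcF hac'
  have hblock : ∀ {d₁ d₂ : Site 2 × Site 2}, d₁ ∈ triBdryDarts D.verts → d₂ ∈ triBdryDarts D.verts →
      d₁.1 ∈ hexFaceVertices F → d₁.2 ∈ hexFaceVertices F → d₂.1 ∈ hexFaceVertices F → d₂.2 ∈ hexFaceVertices F →
      D.stretchIdx₃ (D.dpos d₁) = D.stretchIdx₃ (D.dpos d₂) ∧ frz D m (D.dpos d₁) = frz D m (D.dpos d₂) ∧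
        (D.dpos d₁ < m ↔ D.dpos d₂ < m) :=
    fun hd₁ hd₂ h11 h12 h21 h22 => sameBlock_of_face hm hF hFc hFs hd₁ hd₂ h11 h12 h21 h22
  obtain ⟨hokA, hokB, hokAo, hokBo⟩ := hok
  unfold Phi at hab hbc
  rw [← hmdef] at hab hbc
  by_cases hbG : b ∈ D.verts
  · by_cases hbT : b ∈ T
    · -- b blue: a is yellow
      refine ⟨fun _ h => absurd hbT h, fun hcG hcT => ?_, fun _ hcG hf => ?_, fun _ h => absurd hbG h⟩
      · -- c inner yellow: connect it
        by_cases haG : a ∈ D.verts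
        · have haT : a ∉ T := by
            rw [mk_mem_phiZ_iff_of_mem_mem m T adj_ab haG hbG] at hab
            intro h; exact hab.1 h hbT
          exact yconn_of_adj (hokA haG haT) adj_ac hcG hcT
        · -- a outer, read yellow through (b, a): an A₀-dart after the split; so is (c, a)
          rw [Sym2.eq_swap, mk_mem_phiZ_iff_of_mem_not_mem m T adj_ab.symm hbG haG] at hab
          have hfa : frz D m (D.dpos (b, a)) = false := hab.1 hbT
          have hs2 := hokBo hbG haG hfa
          have hdba : (b, a) ∈ triBdryDarts D.verts := mem_triBdryDarts.2 ⟨hbG, haG, adj_ab.symm⟩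
          have hdca : (c, a) ∈ triBdryDarts D.verts := mem_triBdryDarts.2 ⟨hcG, haG, adj_ac.symm⟩
          obtain ⟨e1, -, e3⟩ := hblock hdba hdca hbF haF hcF haF
          rcases (frz_eq_false_iff m _).1 hfa with h2 | ⟨h0, hge⟩
          · exact absurd h2 hs2
          · rw [Nat.mod_eq_of_lt (D.dpos_lt hdba)] at hge
            have hca : D.dpos (g, o) ≤ D.dpos (c, a) := by
              have : ¬ D.dpos (c, a) < m := fun h => hge (e3.2 h)
              omega
            exact yconn_of_mem_arcFrom (fst_mem_arcFrom hdca (e1 ▸ h0) hca) hcG hcT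
      · -- c outer read yellow through (b, c): not an A₂-dart
        by_cases haG : a ∈ D.verts
        · have haT : a ∉ T := by
            rw [mk_mem_phiZ_iff_of_mem_mem m T adj_ab haG hbG] at hab
            intro h; exact hab.1 h hbT
          intro hs2
          have hdbc : (b, c) ∈ triBdryDarts D.verts := mem_triBdryDarts.2 ⟨hbG, hcG, adj_bc⟩
          have hdac : (a, c) ∈ triBdryDarts D.verts := mem_triBdryDarts.2 ⟨haG, hcG, adj_ac⟩
          obtain ⟨e1, -, -⟩ := hblock hdbc hdac hbF hcF haF hcF
          have ha2 : a ∈ D.arc 2 := by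
            have := fst_mem_arc_stretchIdx hdac; rwa [← e1, hs2] at this
          exact hgoal (yellowCross_of_yconn (hokA haG haT) ha2)
        · rw [Sym2.eq_swap, mk_mem_phiZ_iff_of_mem_not_mem m T adj_ab.symm hbG haG] at hab
          have hfa : frz D m (D.dpos (b, a)) = false := hab.1 hbT
          have hs2 := hokBo hbG haG hfa
          have hdba : (b, a) ∈ triBdryDarts D.verts := mem_triBdryDarts.2 ⟨hbG, haG, adj_ab.symm⟩
          have hdbc : (b, c) ∈ triBdryDarts D.verts := mem_triBdryDarts.2 ⟨hbG, hcG, adj_bc⟩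
          obtain ⟨e1, -, -⟩ := hblock hdba hdbc hbF haF hbF hcF
          rw [← e1]; exact hs2
    · -- b yellow
      have hcb : YConn D g o T b := hokB hbG hbT
      refine ⟨hokB, fun hcG hcT => yconn_of_adj hcb adj_bc hcG hcT, fun _ hcG hf => ?_, fun _ h => absurd hbG h⟩
      rw [mk_mem_phiZ_iff_of_mem_not_mem m T adj_bc hbG hcG] at hbc
      exact absurd (hbc.2 hf) hbT
  · -- b outer: a and c are sites of G reading b through the same block
    have haG : a ∈ D.verts := by
      obtain ⟨x, y, hxy, hx, -⟩ := exists_rep_of_mem_hBonds D (phiZ_subset m T hab)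
      rcases Sym2.eq_iff.1 hxy with ⟨e1, -⟩ | ⟨-, e2⟩
      · exact e1 ▸ hx
      · exact absurd (e2 ▸ hx) hbG
    have hcG : c ∈ D.verts := by
      obtain ⟨x, y, hxy, hx, -⟩ := exists_rep_of_mem_hBonds D (phiZ_subset m T hbc)
      rcases Sym2.eq_iff.1 hxy with ⟨e1, -⟩ | ⟨-, e2⟩
      · exact absurd (e1 ▸ hx) hbG
      · exact e2 ▸ hx
    have hdab : (a, b) ∈ triBdryDarts D.verts := mem_triBdryDarts.2 ⟨haG, hbG, adj_ab⟩
    have hdcb : (c, b) ∈ triBdryDarts D.verts := mem_triBdryDarts.2 ⟨hcG, hbG, adj_bc.symm⟩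
    obtain ⟨e1, e2, -⟩ := hblock hdab hdcb haF hbF hcF hbF
    rw [mk_mem_phiZ_iff_of_mem_not_mem m T adj_ab haG hbG] at hab
    rw [Sym2.eq_swap, mk_mem_phiZ_iff_of_mem_not_mem m T adj_bc.symm hcG hbG] at hbc
    refine ⟨fun h => absurd h hbG, fun _ hcT => ?_, fun h => absurd h hbG, fun _ _ hf => ?_⟩
    · have haT : a ∉ T := fun haT => hcT (hbc.2 (e2 ▸ hab.1 haT))
      exact yconn_of_adj (hokA haG haT) adj_ac hcG hcT
    · rw [← e1]; exact hokAo haG hbG (e2 ▸ hf)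

/-- **the yellow face invariant**. [cite: KhristoforovSmirnov2021, §1.2 Lemma 2, proof (arXiv v1 p. 3)] -/
def PFaceY (D : TriMarkedDomain 3) (g o : Site 2) (T : Finset (Site 2)) (F : HexVertex) : Prop :=
  YellowCross D g o T ∨ ∀ j : Fin 3, side F j ∈ Phi D g o T → OKy D g o T (faceVertex F (j + 1)) (faceVertex F (j + 2))

omit hg ho hadj hst in
/-- reading the yellow invariant of a side given by its endpoints. [folklore] [cite: KhristoforovSmirnov2021, §1.2 Lemma 2, proof (arXiv v1 p. 3)] -/
theorem oky_of_pfaceY {T : Finset (Site 2)} {F : HexVertex} (hP : PFaceY D g o T F) (hgoal : ¬ YellowCross D g o T) {j : Fin 3} {u w : Site 2}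
    (hj : side F j ∈ Phi D g o T) (he : side F j = s(u, w)) : OKy D g o T u w := by
  rcases hP with h | h
  · exact absurd h hgoal
  · have hok := h j hj
    unfold side at he
    rcases Sym2.eq_iff.1 he with ⟨e1, e2⟩ | ⟨e1, e2⟩
    · rw [e1, e2] at hok; exact hok
    · rw [e1, e2] at hok; exact oky_symm hok

omit hst in
/-- when `z` is the first mid-edge of `A₀` and `g` is yellow, the crossing is trivial (`g = v₀ ∈ A₀ ∩ A₂`). [cite: KhristoforovSmirnov2021, §2 eq. (4) (arXiv v1 p. 5)] -/
theorem yellowCross_of_first {T : Finset (Site 2)} (hgT : g ∉ T) (hp : D.dpos (g, o) = 0) : YellowCross D g o T := by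
  have hd := zdart_mem hg ho hadj
  have e : (g, o) = D.markDart 0 := by
    rw [← bdart_dpos hd, hp]; show bdart D 0 = triBdryIter D.verts D.base (D.pos 0); rw [pos_facts.1]; rfl
  have hg2 : g ∈ D.arc 2 := by
    have : g = D.markSite 0 := congrArg Prod.fst e
    rw [this]; exact markSite_mem_arc_sub_one 0
  have hst0 : D.stretchIdx₃ (D.dpos (g, o)) = 0 := by rw [hp]; exact D.stretchIdx_zero₃
  exact ⟨g, fst_mem_arcFrom hd hst0 le_rfl, g, hg2, PathIn.refl ⟨Finset.mem_coe.2 hg, fun h => hgT (Finset.mem_coe.1 h)⟩⟩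

/-- ★ **BASE of the yellow propagation** at the odd endpoint `sOf σ`. [cite: KhristoforovSmirnov2021, §1.2 Lemma 2, proof (arXiv v1 p. 3)] -/
theorem pfaceY_sOf (T : Finset (Site 2)) : PFaceY D g o T (sOf D g o T) := by
  classical
  by_cases hgoal : YellowCross D g o T
  · exact Or.inl hgoal
  have hd := zdart_mem hg ho hadj
  have hpL := D.dpos_lt hd
  have hp1 := zpos_lt_pos_one hg ho hadj hst
  obtain ⟨h00, h01, h12, h2L⟩ := pos_facts (D := D)
  set m := mOf D g o T with hmdef
  set p := D.dpos (g, o) with hpdef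
  set d := bdart D (m + (#(triBdryDarts D.verts) - 1)) with hdd
  have hdm : d ∈ triBdryDarts D.verts := bdart_mem _
  obtain ⟨hd1, hd2, hdadj⟩ := mem_triBdryDarts.1 hdm
  have hsucc : triBdrySucc D.verts d = bdart D m := succ_bdart_pred m
  have hsm : triBdrySucc D.verts d ∈ triBdryDarts D.verts := triBdrySucc_mem hdm
  have hsF : sOf D g o T = leftFace d.1 d.2 := rfl
  have hverts : hexFaceVertices (sOf D g o T) = {d.1, d.2, triLeftApex d.1 d.2} := by rw [hsF, hexFaceVertices_leftFace hdadj]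
  have hmle : m ≤ D.pos 1 := mOf_le hg ho hadj hst T
  -- `0 < m` (else the crossing is trivial)
  have hmpos : 0 < m := by
    by_contra h0
    have hm0 : m = 0 := by omega
    have hgT : g ∉ T := by
      intro hgT
      have : m = p + 1 := by rw [hmdef]; unfold mOf; rw [if_pos hgT]
      omega
    have : m = p := by rw [hmdef]; unfold mOf; rw [if_neg hgT]
    exact hgoal (yellowCross_of_first hg ho hadj hgT (by omega))
  have hcase : (g ∈ T ∧ m = p + 1 ∧ d = (g, o)) ∨ (g ∉ T ∧ m = p ∧ triBdrySucc D.verts d = (g, o)) := by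
    by_cases hgT : g ∈ T
    · have hm1 : m = p + 1 := by rw [hmdef]; unfold mOf; rw [if_pos hgT]
      refine Or.inl ⟨hgT, hm1, ?_⟩
      rw [hdd, hm1, show p + 1 + (#(triBdryDarts D.verts) - 1) = p + #(triBdryDarts D.verts) by omega]
      unfold bdart; rw [D.isTriDisc.iter_add_card, hpdef, D.iter_dpos hd]
    · have hm0 : m = p := by rw [hmdef]; unfold mOf; rw [if_neg hgT]
      refine Or.inr ⟨hgT, hm0, ?_⟩
      rw [hsucc, hm0, hpdef, bdart_dpos hd]
  -- positions of `d` and `succ d`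
  have hdpos : D.dpos d = m - 1 := by
    rw [hdd, dpos_bdart, show m + (#(triBdryDarts D.verts) - 1) = (m - 1) + #(triBdryDarts D.verts) by omega, Nat.add_mod_right,
      Nat.mod_eq_of_lt (by omega)]
  have hspos : D.dpos (triBdrySucc D.verts d) = m := by rw [hsucc, dpos_bdart, Nat.mod_eq_of_lt (by omega)]
  -- (1) inner yellow vertices of the split face are yellow-connected
  have hconn : ∀ x ∈ hexFaceVertices (sOf D g o T), x ∈ D.verts → x ∉ T → YConn D g o T x := by
    intro x hx hxG hxT
    rw [hverts, Finset.mem_insert, Finset.mem_insert, Finset.mem_singleton] at hx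
    have hgc : g ∉ T → YConn D g o T g := fun hgT => yconn_of_mem_arcFrom (fst_mem_arcFrom hd hst le_rfl) hg hgT
    rcases hx with rfl | rfl | rfl
    · -- the tail d.1
      rcases hcase with ⟨hgT, -, hdg⟩ | ⟨hgT, -, hsg⟩
      · rw [hdg] at hxT; exact absurd hgT hxT
      · unfold triBdrySucc at hsg
        split_ifs at hsg with hw
        · -- succ d = (apex, d.2) = (g, o): d.1 is adjacent to the apex g
          have e1 : triLeftApex d.1 d.2 = g := congrArg Prod.fst hsg
          exact yconn_of_adj (hgc hgT) (e1 ▸ (triGraph_adj_triLeftApex_left hdadj)).symm hxG hxT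
        · have e1 : d.1 = g := congrArg Prod.fst hsg
          rw [e1]; exact hgc hgT
    · exact absurd hxG hd2
    · -- the apex
      rcases hcase with ⟨hgT, hm1, hdg⟩ | ⟨hgT, -, hsg⟩
      · -- succ d = (apex, o) at position p + 1 of A₀
        have hsg : triBdrySucc D.verts d = (triLeftApex d.1 d.2, d.2) := by unfold triBdrySucc; rw [if_pos hxG]
        have hst' : D.stretchIdx₃ (D.dpos (triBdrySucc D.verts d)) = 0 := by
          rw [hspos]
          by_contra hne
          -- position m = p + 1 is then the mark 1: succ d = markDart 1 has tail v₁ = g = d.1, not the apex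
          have hm1' : m = D.pos 1 := by
            by_contra hne'
            exact hne (stretchIdx_zero_of_lt (by rw [Nat.mod_eq_of_lt (by omega)]; omega))
          have hmk : triBdrySucc D.verts d = D.markDart 1 := by
            rw [hsucc, hm1']; rfl
          have hpd : d = predDart D 1 := by
            have := iter_eq_predDart (D := D) (n := D.dpos d) (i := 1) (by rw [← D.dpos_succ hdm, hmk, dpos_markDart])
            rwa [D.iter_dpos hdm] at this
          have e1 : (triBdrySucc D.verts d).1 = d.1 := by rw [hmk, hpd, predDart_fst]; rfl
          rw [hsg] at e1
          exact (triGraph_adj_triLeftApex_left hdadj).ne e1.symm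
        have hmem := fst_mem_arcFrom (g := g) (o := o) hsm hst' (by rw [hspos]; omega)
        rw [hsg] at hmem
        exact yconn_of_mem_arcFrom hmem hxG hxT
      · unfold triBdrySucc at hsg
        rw [if_pos hxG] at hsg
        have : triLeftApex d.1 d.2 = g := congrArg Prod.fst hsg
        rw [this]; exact hgc hgT
  -- (2) no dart of the split face is read as a yellow `A₂`-dart
  have hdarts : ∀ a c : Site 2, a ∈ D.verts → c ∉ D.verts → triGraph.Adj a c → a ∈ hexFaceVertices (sOf D g o T) →
      c ∈ hexFaceVertices (sOf D g o T) → frz D m (D.dpos (a, c)) = false → D.stretchIdx₃ (D.dpos (a, c)) ≠ 2 := by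
    intro a c haG hcG hac h1 h2 hf
    have hd' : (a, c) ∈ triBdryDarts D.verts := mem_triBdryDarts.2 ⟨haG, hcG, hac⟩
    obtain ⟨j, hj, hj1⟩ := exists_eq_faceVertex_of_adj hdadj
    rw [hsF] at h1 h2
    have hdj : d = (faceVertex (leftFace d.1 d.2) j, faceVertex (leftFace d.1 d.2) (j + 1)) := Prod.ext hj hj1
    rcases bdryDart_of_face_eq (D := D) (hj ▸ hd1) (hj1 ▸ hd2) hd' h1 h2 with e | e
    · -- the dart `d`: position m - 1 of A₀, blue
      rw [← hdj] at e
      rw [e, hdpos, frz_of_stretchIdx_zero (stretchIdx_zero_of_lt (by rw [Nat.mod_eq_of_lt (by omega)]; omega)),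
        Nat.mod_eq_of_lt (by omega)] at hf
      have : m - 1 < m := by omega
      simp [this] at hf
    · -- the dart `succ d`: position m ≤ pos 1, stretch 0 or 1
      rw [← hdj] at e
      rw [e, hspos]
      rcases hmle.lt_or_eq with hlt | heq
      · rw [stretchIdx_zero_of_lt (by rw [Nat.mod_eq_of_lt (by omega)]; exact hlt)]; decide
      · rw [heq, ← dpos_markDart D 1, stretchIdx₃_markDart]; decide
  right
  intro j hj
  have hv1 := faceVertex_mem (sOf D g o T) (j + 1)
  have hv2 := faceVertex_mem (sOf D g o T) (j + 2)
  have hne : faceVertex (sOf D g o T) (j + 1) ≠ faceVertex (sOf D g o T) (j + 2) :=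
    fun e => fin3_ne_add_one (j + 1) (by rw [fin3_add_one_add_one]; exact faceVertex_injective _ e)
  have hadj12 := adj_of_mem_hexFaceVertices hv1 hv2 hne
  unfold OKy
  refine ⟨?_, ?_, ?_, ?_⟩
  · intro h1 h2; exact hconn _ hv1 h1 h2
  · intro h1 h2; exact hconn _ hv2 h1 h2
  · intro h1 h2 hf
    rw [← hmdef] at hf
    exact hdarts _ _ h1 h2 hadj12 hv1 hv2 hf
  · intro h1 h2 hf
    rw [← hmdef] at hf
    exact hdarts _ _ h1 h2 hadj12.symm hv2 hv1 hf

/-- ★ **END of the yellow propagation** at the corner `y₀ ≠ sOf σ`. [cite: KhristoforovSmirnov2021, §1.2 Lemma 2, proof (arXiv v1 p. 3)] -/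
theorem yellowCross_of_pfaceY_yc_zero {v : HexVertex} {i : Fin 3} (he : side v i = s(g, o)) (T : Finset (Site 2))
    (hP : PFaceY D g o T (yc D 0)) (hne : yc D 0 ≠ sOf D g o T) : YellowCross D g o T := by
  classical
  by_contra hgoal
  obtain ⟨h00, h01, h12, h2L⟩ := pos_facts (D := D)
  set m := mOf D g o T with hmdef
  have hm : m ≤ D.pos 1 := mOf_le hg ho hadj hst T
  have hm0 : m ≠ 0 := fun e => hne (by rw [← sFace_pos_eq_yc 0, h00, ← e]; rfl)
  -- y₀ is odd in Φ(σ), so it has a side in it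
  have hξ := Phi_mem_TXb hg ho hadj hst he T
  rw [mem_TXb_iff] at hξ
  have hodd : Odd (xiDeg (Phi D g o T) (yc D 0)) := (hξ.2 _ (yc_mem_touching D 0)).2 (by
    rw [Finset.mem_symmDiff, Finset.mem_singleton]; exact Or.inl ⟨yc_mem_corners D 0, hne⟩)
  obtain ⟨j, hj⟩ : ∃ j : Fin 3, side (yc D 0) j ∈ Phi D g o T := by
    by_contra hno
    push Not at hno
    rw [l1_xiDeg_eq, Finset.filter_eq_empty_iff.2 (fun j _ => hno j), Finset.card_empty] at hodd
    exact absurd hodd (by decide)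
  obtain ⟨w, hw, hw1, hw2, hor⟩ := isCornerFace_typeII D (yc_spec D 0)
  have hv0G : faceVertex (yc D 0) w ∈ D.verts := hw ▸ markSite_mem D 0
  obtain ⟨s2, s1, s0⟩ := sides_from (yc D 0) w
  have hside : side (yc D 0) j = s(faceVertex (yc D 0) w, faceVertex (yc D 0) (w + 1)) ∨
      side (yc D 0) j = s(faceVertex (yc D 0) w, faceVertex (yc D 0) (w + 2)) := by
    rcases fin3_cases_z w j with rfl | rfl | rfl
    · exfalso
      rw [s0] at hj
      obtain ⟨a, b, hab, ha, -⟩ := exists_rep_of_mem_hBonds D (phiZ_subset _ T hj)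
      rcases Sym2.eq_iff.1 hab with ⟨e1, -⟩ | ⟨-, e2⟩
      · exact hw1 (e1 ▸ ha)
      · exact hw2 (e2 ▸ ha)
    · exact Or.inr (by rw [s1, Sym2.eq_swap])
    · exact Or.inl s2
  -- frame colours of the two darts at v₀
  have hpd : D.dpos (predDart D 0) = #(triBdryDarts D.verts) - 1 := by
    show D.dpos (bdart D (D.pos 0 + (#(triBdryDarts D.verts) - 1))) = _
    rw [dpos_bdart, h00, Nat.zero_add, Nat.mod_eq_of_lt (by omega)]
  have hs_pred : D.stretchIdx₃ (D.dpos (predDart D 0)) = 2 := by rw [hpd]; exact D.stretchIdx_last₃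
  have hfr_pred : frz D m (D.dpos (predDart D 0)) = false := frz_of_stretchIdx_two hs_pred
  have hfr_mark : frz D m (D.dpos (D.markDart 0)) = true := by
    rw [dpos_markDart, h00, frz_of_stretchIdx_zero D.stretchIdx_zero₃, Nat.zero_mod]
    have : 0 < m := Nat.pos_of_ne_zero hm0
    simp [this]
  have key : ∀ {u : Site 2}, u ∉ D.verts → (u = (predDart D 0).2 ∨ u = (D.markDart 0).2) →
      side (yc D 0) j = s(faceVertex (yc D 0) w, u) → s(faceVertex (yc D 0) w, u) ∈ Phi D g o T → False := by
    intro u huG hu hsd hmem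
    have hok := oky_of_pfaceY hP hgoal hj hsd
    obtain ⟨hokA, -, hokAo, -⟩ := hok
    have hadj' : triGraph.Adj (faceVertex (yc D 0) w) u := by
      have := phiZ_subset _ T hmem
      obtain ⟨a, b, hab, -, hadj''⟩ := exists_rep_of_mem_hBonds D this
      rcases Sym2.eq_iff.1 hab with ⟨e1, e2⟩ | ⟨e1, e2⟩
      · rw [e1, e2]; exact hadj''
      · rw [e1, e2]; exact hadj''.symm
    unfold Phi at hmem
    rw [← hmdef, mk_mem_phiZ_iff_of_mem_not_mem m T hadj' hv0G huG] at hmem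
    rcases hu with rfl | rfl
    · have e : (faceVertex (yc D 0) w, (predDart D 0).2) = predDart D 0 := Prod.ext (by rw [predDart_fst]; exact hw) rfl
      rw [e] at hmem hokAo
      exact hokAo hv0G huG hfr_pred hs_pred
    · have e : (faceVertex (yc D 0) w, (D.markDart 0).2) = D.markDart 0 := Prod.ext hw rfl
      rw [e] at hmem
      have hvT : faceVertex (yc D 0) w ∉ T := fun h => by rw [hmem.1 h] at hfr_mark; exact absurd hfr_mark (by decide)
      exact hgoal (yellowCross_of_yconn (hokA hv0G hvT) (hw ▸ markSite_mem_arc_sub_one 0))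
  rcases hside with hsd | hsd
  · rcases hor with ⟨e1, -⟩ | ⟨e1, -⟩
    · exact key (e1 ▸ hw1) (Or.inl e1) hsd (hsd ▸ hj)
    · exact key (e1 ▸ hw1) (Or.inr e1) hsd (hsd ▸ hj)
  · rcases hor with ⟨-, e2⟩ | ⟨-, e2⟩
    · exact key (e2 ▸ hw2) (Or.inr e2) hsd (hsd ▸ hj)
    · exact key (e2 ▸ hw2) (Or.inl e2) hsd (hsd ▸ hj)

/-- **the yellow propagation step between faces.** [cite: KhristoforovSmirnov2021, §1.2 Lemma 2, proof (arXiv v1 p. 3)] -/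
theorem pfaceY_step {v : HexVertex} (hv : AllSides D v) {i : Fin 3} (he : side v i = s(g, o)) (T : Finset (Site 2)) {F F' : HexVertex}
    (hP : PFaceY D g o T F) (hFF' : (sideGraph (Phi D g o T)).Adj F F') : PFaceY D g o T F' := by
  classical
  by_cases hgoal : YellowCross D g o T
  · exact Or.inl hgoal
  by_cases hFs : F' = sOf D g o T
  · rw [hFs]; exact pfaceY_sOf hg ho hadj hst T
  obtain ⟨j, rfl, hj⟩ := hFF'
  set ξ := Phi D g o T with hξdef
  have hξT := Phi_mem_TXb hg ho hadj hst he T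
  have hsub : ξ ⊆ hBonds D := fun b hb => phiZ_subset _ T hb
  set k := oppIdx F j with hk
  set F' := oppFace F j with hF'def
  have hshared : side F' k = side F j := side_oppFace_oppIdx F j
  have hjk' : side F' k ∈ ξ := by rw [hshared]; exact hj
  have hokk : OKy D g o T (faceVertex F' (k + 1)) (faceVertex F' (k + 2)) := by
    have := oky_of_pfaceY hP hgoal hj (rfl : side F j = s(faceVertex F (j + 1), faceVertex F (j + 2)))
    rw [hF'def, hk, faceVertex_oppFace_succ, faceVertex_oppFace_succ_succ]
    exact oky_symm this
  right
  intro j' hj'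
  by_cases hjk : j' = k
  · rw [hjk]; exact hokk
  have hF't : F' ∈ triFacesTouching D.verts := mem_touching_of_side_mem D (hsub hj')
  have hs := sOf_mem_pair hg ho hadj hv he T
  have hdeg := xiDeg_le_two_of_mem_TXb D i hs hξT F'
  have hge : 2 ≤ xiDeg ξ F' := by
    rw [l1_xiDeg_eq]
    have hsub2 : ({k, j'} : Finset (Fin 3)) ⊆ ((Finset.univ : Finset (Fin 3)).filter fun i => side F' i ∈ ξ) := by
      intro x hx
      rw [Finset.mem_insert, Finset.mem_singleton] at hx
      rw [Finset.mem_filter]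
      rcases hx with rfl | rfl
      · exact ⟨Finset.mem_univ _, hjk'⟩
      · exact ⟨Finset.mem_univ _, hj'⟩
    have hc : #({k, j'} : Finset (Fin 3)) = 2 := Finset.card_pair (Ne.symm hjk)
    calc 2 = #({k, j'} : Finset (Fin 3)) := hc.symm
      _ ≤ _ := Finset.card_le_card hsub2
  have h2 : xiDeg ξ F' = 2 := le_antisymm hdeg hge
  have heven : ¬ Odd (xiDeg ξ F') := by rw [h2]; decide
  have hFc : F' ∉ corners D := by
    intro hc
    have hξT' := hξT
    rw [mem_TXb_iff] at hξT'
    apply heven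
    apply (hξT'.2 _ hF't).2
    rw [Finset.mem_symmDiff, Finset.mem_singleton]; exact Or.inl ⟨hc, hFs⟩
  obtain ⟨s2, s1, s0⟩ := sides_from F' k
  have hx0 := faceVertex_mem F' k
  have hx1 := faceVertex_mem F' (k + 1)
  have hx2 := faceVertex_mem F' (k + 2)
  have n01 : faceVertex F' k ≠ faceVertex F' (k + 1) := fun e => fin3_ne_add_one k (faceVertex_injective _ e)
  have n02 : faceVertex F' k ≠ faceVertex F' (k + 2) := fun e => fin3_ne_add_two k (faceVertex_injective _ e)
  have n12 : faceVertex F' (k + 1) ≠ faceVertex F' (k + 2) :=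
    fun e => fin3_add_two_ne_add_one k (faceVertex_injective _ e).symm
  have hab : s(faceVertex F' (k + 1), faceVertex F' (k + 2)) ∈ ξ := by rw [← s0]; exact hjk'
  rcases fin3_cases_z k j' with e | e | e
  · exact absurd e hjk
  · rw [e] at hj' ⊢
    rw [s1] at hj'
    have step := oky_step hg ho hadj hst T hF't hFc hFs hx1 hx2 hx0 n12 (Ne.symm n02) (Ne.symm n01) hab hj' hokk
    rw [fin3_add_one_add_one, fin3_add_one_add_two]
    rcases step with h | h
    · exact absurd h hgoal
    · exact h
  · rw [e] at hj' ⊢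
    rw [s2] at hj'
    have hba : s(faceVertex F' (k + 2), faceVertex F' (k + 1)) ∈ ξ := by rw [Sym2.eq_swap]; exact hab
    have hbc : s(faceVertex F' (k + 1), faceVertex F' k) ∈ ξ := by rw [Sym2.eq_swap]; exact hj'
    have step := oky_step hg ho hadj hst T hF't hFc hFs hx2 hx1 hx0 (Ne.symm n12) (Ne.symm n01) (Ne.symm n02) hba hbc
      (oky_symm hokk)
    rw [fin3_add_two_add_one, fin3_add_two_add_two]
    rcases step with h | h
    · exact absurd h hgoal
    · exact oky_symm h

/-- ★ **(B) THE CLASS `[z ↔ y₀]` FORCES THE YELLOW CROSSING `∂_{z y₁} ↔ A₂`.** [cite: KhristoforovSmirnov2021, §1.2 Lemma 2, proof (arXiv v1 p. 3)] -/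
theorem yellowCross_of_reachable {v : HexVertex} (hv : AllSides D v) {i : Fin 3} (he : side v i = s(g, o)) (T : Finset (Site 2))
    (hR : (sideGraph (Phi D g o T)).Reachable (sOf D g o T) (yc D 0)) : YellowCross D g o T := by
  classical
  have hP : ∀ F, Relation.ReflTransGen (sideGraph (Phi D g o T)).Adj (sOf D g o T) F → PFaceY D g o T F := by
    intro F h
    induction h with
    | refl => exact pfaceY_sOf hg ho hadj hst T
    | tail _ hbc ih => exact pfaceY_step hg ho hadj hst hv he T ih hbc
  have hP0 := hP (yc D 0) ((SimpleGraph.reachable_iff_reflTransGen _ _).1 hR)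
  by_cases hne : yc D 0 = sOf D g o T
  · obtain ⟨h00, h01, h12, h2L⟩ := pos_facts (D := D)
    have hm : mOf D g o T = D.pos 0 :=
      eq_pos_of_sFace_eq_yc (lt_of_le_of_lt (mOf_le hg ho hadj hst T) (by omega)) hne.symm
    rw [h00] at hm
    have hgT : g ∉ T := by
      intro hgT
      unfold mOf at hm; rw [if_pos hgT] at hm; omega
    unfold mOf at hm; rw [if_neg hgT] at hm
    exact yellowCross_of_first hg ho hadj hgT hm
  · exact yellowCross_of_pfaceY_yc_zero hg ho hadj hst he T hP0 hne

end Yellow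

/-! ### (C) exclusivity, (D) the two classes, and the dictionary -/

section Dictionary

variable {D : TriMarkedDomain 3}
variable {g o : Site 2} (hg : g ∈ D.verts) (ho : o ∉ D.verts) (hadj : triGraph.Adj g o) (hst : D.stretchIdx₃ (D.dpos (g, o)) = 0)

include hg ho hadj hst in
/-- ★ **(C) the two crossings do not coexist** (Bollobás–Riordan's «but not both», the tree's `IsTriDisc.not_interleaved`: a blue path
`∂_{y₀ z} → A₁` and a yellow path `∂_{z y₁} → A₂` would be interleaved along the boundary cycle). [cite: BollobasRiordan2006, Ch. 7 Lemma 5 (p. 193; proof pp. 193–195)] -/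
theorem not_blueCross_of_yellowCross (T : Finset (Site 2)) (hB : BlueCross D g o T) (hY : YellowCross D g o T) : False := by
  obtain ⟨h00, h01, h12, h2L⟩ := pos_facts (D := D)
  have hp1 := zpos_lt_pos_one hg ho hadj hst
  obtain ⟨a, ha, b, hb, hP⟩ := hB
  obtain ⟨c, hc, d, hd, hQ⟩ := hY
  obtain ⟨na, hna, rfl⟩ := exists_of_mem_arcTo ha
  obtain ⟨nc, hnc, hnc1, rfl⟩ := exists_of_mem_arcFrom hc
  obtain ⟨nb, hnb1, hnb2, rfl⟩ := D.mem_arc_iff.1 hb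
  obtain ⟨nd, hnd1, hnd2, rfl⟩ := D.mem_arc_iff.1 hd
  rw [D.nextPos_of_lt₃ 1 (by decide)] at hnb2
  rw [D.nextPos_two₃] at hnd2
  change nb < D.pos 2 at hnb2
  by_cases hac : na = nc
  · subst hac
    have h1 := hP.left_mem
    have h2 := hQ.left_mem
    exact h2.2 h1.2
  · have h1 : na < nc := by omega
    exact D.isTriDisc.not_interleaved (↑T : Set (Site 2)) h1 (by omega) (by omega) hnd2 hP hQ

include hg ho hst in
/-- ★ **(D) on the arc `A₀` the strand from `z` ends at `y₀` or at `y₁`** (the class `[z ↔ y₂]` is absent: `not_reachable_yc_two` of the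
loop-side file). [cite: KhristoforovSmirnov2021, §2 eq. (4) (arXiv v1 p. 5)] -/
theorem reachable_zero_or_one {v : HexVertex} (hv : AllSides D v) {i : Fin 3} (he : side v i = s(g, o)) {s : HexVertex}
    (hs : s ∈ ({v, oppFace v i} : Finset HexVertex)) {ξ : Finset (Sym2 (Site 2))} (hξ : ξ ∈ TXb D v i s) :
    (sideGraph ξ).Reachable s (yc D 0) ∨ (sideGraph ξ).Reachable s (yc D 1) := by
  obtain ⟨j, hj, -⟩ := existsUnique_inClassX D hv i hs hξ
  rw [hbK_inClassX_iff] at hj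
  obtain ⟨-, hR⟩ := hj
  have hj3 : j = 0 ∨ j = 1 ∨ j = 2 := by fin_cases j <;> simp
  rcases hj3 with rfl | rfl | rfl
  · exact Or.inl hR
  · exact Or.inr hR
  · exfalso
    by_cases hsc : s ∈ corners D
    · have hs2 : yc D 2 ≠ s := by
        rw [Finset.mem_insert, Finset.mem_singleton] at hs
        rcases hs with rfl | rfl
        · exact (ne_yc_two_of_stretch_zero (j := i) he hg ho hst).symm
        · exact (ne_yc_two_of_stretch_zero (j := oppIdx v i) (by rw [side_oppFace_oppIdx]; exact he) hg ho hst).symm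
      exact not_reachable_of_corner_end hv i hs hsc hξ hs2 hR
    · exact not_reachable_yc_two hv hs hsc he hg ho hst hξ hR

variable {v : HexVertex} (hv : AllSides D v) {i : Fin 3} (he : side v i = s(g, o))
include hg ho hadj hst hv he

/-- ★★ **KHRISTOFOROV–SMIRNOV'S LEMMA 2 AT `(y₀, z, y₁, y₂)`, first link pattern**: for a colouring `σ` of `G`, the strand of `ξ(σ)` from
`z` ends at `y₁` (the class `[z ↔ u_{j−1}]`) iff `σ` has a blue crossing `∂_{y₀ z} ↔ A₁`. [cite: KhristoforovSmirnov2021, §1.2 Lemma 2 (arXiv v1 p. 3): «∂_{u₁u₂}Ω ↔ ∂_{u₃u₄}Ω in σ if and only if [u₁u₄|u₂u₃] in ξ(σ)»] -/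
theorem inClassX_one_iff_blueCross (T : Finset (Site 2)) :
    InClassX D (faceVertex v (i + 1)) (faceVertex v (i + 2)) (sOf D g o T) 1 (Phi D g o T) ↔ BlueCross D g o T := by
  have hξ := Phi_mem_TXb hg ho hadj hst he T
  have hs := sOf_mem_pair hg ho hadj hv he T
  rw [hbK_inClassX_iff]
  constructor
  · rintro ⟨-, hR⟩
    exact blueCross_of_reachable hg ho hadj hst hv he T hR
  · intro hB
    refine ⟨hξ, ?_⟩
    rcases reachable_zero_or_one hg ho hst hv he hs hξ with hR | hR
    · exact absurd (yellowCross_of_reachable hg ho hadj hst hv he T hR) (fun hY => not_blueCross_of_yellowCross hg ho hadj hst T hB hY)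
    · exact hR

/-- ★★ **KHRISTOFOROV–SMIRNOV'S LEMMA 2 AT `(y₀, z, y₁, y₂)`, second link pattern**: the strand from `z` ends at `y₀` iff `σ` has a
yellow crossing `∂_{z y₁} ↔ A₂`. [cite: KhristoforovSmirnov2021, §1.2 Lemma 2 (arXiv v1 p. 3)] -/
theorem inClassX_zero_iff_yellowCross (T : Finset (Site 2)) :
    InClassX D (faceVertex v (i + 1)) (faceVertex v (i + 2)) (sOf D g o T) 0 (Phi D g o T) ↔ YellowCross D g o T := by
  have hξ := Phi_mem_TXb hg ho hadj hst he T
  have hs := sOf_mem_pair hg ho hadj hv he T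
  rw [hbK_inClassX_iff]
  constructor
  · rintro ⟨-, hR⟩
    exact yellowCross_of_reachable hg ho hadj hst hv he T hR
  · intro hY
    refine ⟨hξ, ?_⟩
    rcases reachable_zero_or_one hg ho hst hv he hs hξ with hR | hR
    · exact hR
    · exact absurd (blueCross_of_reachable hg ho hadj hst hv he T hR) (fun hB => not_blueCross_of_yellowCross hg ho hadj hst T hB hY)

/-! ### counting: `N_j(z)` = the number of colourings with the corresponding crossing -/

open Classical in
/-- **transport of counts through `Φ`**: the number of colourings of `G` whose loop configuration is in class `j` is `N_j(z)` (both halves).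
[cite: KhristoforovSmirnov2021, §1.2 Lemma 2, proof (arXiv v1 p. 3): «This map is a bijection»; §2 Definition 3 (p. 4)] -/
theorem classCount_eq_card_filter (j : Fin 3) :
    classCount D v i j = #(D.verts.powerset.filter fun T =>
      InClassX D (faceVertex v (i + 1)) (faceVertex v (i + 2)) (sOf D g o T) j (Phi D g o T)) := by
  -- for each odd endpoint `s`, the colourings with `sOf = s` in class `j` biject onto the class-`j` part of `TXb … s`
  have key : ∀ s ∈ ({v, oppFace v i} : Finset HexVertex),
      #((TXb D v i s).filter fun ξ => InClassX D (faceVertex v (i + 1)) (faceVertex v (i + 2)) s j ξ) =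
        #(D.verts.powerset.filter fun T => sOf D g o T = s ∧
          InClassX D (faceVertex v (i + 1)) (faceVertex v (i + 2)) (sOf D g o T) j (Phi D g o T)) := by
    intro s hs
    symm
    apply Finset.card_bij (fun T _ => Phi D g o T)
    · intro T hT
      rw [Finset.mem_filter] at hT ⊢
      obtain ⟨-, hsT, hcl⟩ := hT
      rw [hsT] at hcl
      exact ⟨hsT ▸ Phi_mem_TXb hg ho hadj hst he T, hcl⟩
    · intro T hT T' hT' h
      exact Phi_injOn hg ho hadj hst he (Finset.mem_coe.2 (Finset.mem_filter.1 hT).1) (Finset.mem_coe.2 (Finset.mem_filter.1 hT').1) h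
    · intro ξ hξ
      rw [Finset.mem_filter] at hξ
      obtain ⟨T, hTG, hTξ, hTs⟩ := exists_eq_Phi hg ho hadj hst hv he hs hξ.1
      refine ⟨T, ?_, hTξ⟩
      rw [Finset.mem_filter, Finset.mem_powerset]
      refine ⟨hTG, hTs, ?_⟩
      rw [hTs, hTξ]; exact hξ.2
  have hvo : v ≠ oppFace v i := h1_ne_oppFace v i
  unfold classCount
  rw [key v (by simp), key (oppFace v i) (by simp), ← Finset.card_union_of_disjoint]
  · congr 1
    ext T
    simp only [Finset.mem_union, Finset.mem_filter]
    constructor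
    · rintro (⟨h1, -, h2⟩ | ⟨h1, -, h2⟩) <;> exact ⟨h1, h2⟩
    · rintro ⟨h1, h2⟩
      have hs := sOf_mem_pair hg ho hadj hv he T
      rw [Finset.mem_insert, Finset.mem_singleton] at hs
      rcases hs with e | e
      · exact Or.inl ⟨h1, e, h2⟩
      · exact Or.inr ⟨h1, e, h2⟩
  · rw [Finset.disjoint_filter]
    intro T _ h1 h2
    exact hvo (h1.1.symm.trans h2.1)

open Classical in
/-- ★★★ **`N₁(z)` IS THE NUMBER OF COLOURINGS WITH A BLUE CROSSING `∂_{y₀ z} ↔ A₁`** (frame `A₀`: `z` on the arc from `v₀` to `v₁`).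
[cite: KhristoforovSmirnov2021, §1.2 Lemma 2 (arXiv v1 p. 3) and §2 eq. (4) (p. 5)] -/
theorem classCount_one_eq_card_blueCross :
    classCount D v i 1 = #(D.verts.powerset.filter fun T => BlueCross D g o T) := by
  rw [classCount_eq_card_filter hg ho hadj hst hv he 1]
  congr 1
  exact Finset.filter_congr fun T _ => inClassX_one_iff_blueCross hg ho hadj hst hv he T

open Classical in
/-- ★★★ **`N₀(z)` IS THE NUMBER OF COLOURINGS WITH A YELLOW CROSSING `∂_{z y₁} ↔ A₂`.** [cite: KhristoforovSmirnov2021, §1.2 Lemma 2 (arXiv v1 p. 3) and §2 eq. (4) (p. 5)] -/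
theorem classCount_zero_eq_card_yellowCross :
    classCount D v i 0 = #(D.verts.powerset.filter fun T => YellowCross D g o T) := by
  rw [classCount_eq_card_filter hg ho hadj hst hv he 0]
  congr 1
  exact Finset.filter_congr fun T _ => inClassX_zero_iff_yellowCross hg ho hadj hst hv he T

/-! ### the probabilities: Khristoforov–Smirnov's eq. (4), percolation side, on the arc `A₀` -/

/-- **the event `∂_{y₀ z} ↔ A₁`** (an open = blue path of `G` from the sub-arc to the arc) as a set of site configurations.
[cite: KhristoforovSmirnov2021, §1.1 (arXiv v1 p. 2) and §2 eq. (4) (p. 5)] -/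
def arcToCrossing (D : TriMarkedDomain 3) (g o : Site 2) : Set (SiteConfig (Site 2)) :=
  {σ | ∃ a ∈ arcTo D g o, ∃ b ∈ D.arc 1, PathIn triGraph ((D.verts : Set (Site 2)) ∩ σ) a b}

/-- **the event `∂_{z y₁} ↔ A₂` in the closed (= yellow) colour.** [cite: KhristoforovSmirnov2021, §1.1 (arXiv v1 p. 2) and §2 eq. (4) (p. 5)] -/
def arcFromClosedCrossing (D : TriMarkedDomain 3) (g o : Site 2) : Set (SiteConfig (Site 2)) :=
  {σ | ∃ a ∈ arcFrom D g o, ∃ b ∈ D.arc 2, PathIn triGraph ((D.verts : Set (Site 2)) ∩ σᶜ) a b}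

omit hg ho hadj hst hv he in
/-- locality of paths inside `G`: only the states of the sites of `G` matter. [folklore] -/
private theorem inter_eq_inter_inter (σ : Set (Site 2)) :
    (D.verts : Set (Site 2)) ∩ σ = (D.verts : Set (Site 2)) ∩ (σ ∩ (D.verts : Set (Site 2))) := by
  ext x; simp only [Set.mem_inter_iff]; tauto

omit hg ho hadj hst hv he in
/-- locality, complement version. [folklore] -/
private theorem inter_compl_eq (σ : Set (Site 2)) :
    (D.verts : Set (Site 2)) ∩ σᶜ = (D.verts : Set (Site 2)) ∩ (σ ∩ (D.verts : Set (Site 2)))ᶜ := by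
  ext x; simp only [Set.mem_inter_iff, Set.mem_compl_iff]; tauto

open Classical in
/-- ★★★ **KhS eq. (4), PERCOLATION SIDE, `H₁`**: at a boundary mid-edge `z` of the arc `A₀` (from `v₀` to `v₁`),
`H₁(z) = P_{1/2}[∂_{y₀ z}Ω ↔ A₁]` — the probability of an open crossing of `G` from the sub-arc between `v₀` and `z` to the arc `A₁`
(printed: `F(z) = P[∂_{j+1,z}Ω ↔ ∂_{j−1,j}Ω]·τ^{j−1} + …` with `u_{j−1} = y₁`). [cite: KhristoforovSmirnov2021, §2 eq. (4) (arXiv v1 p. 5) with §1.2 Lemma 2 (p. 3)] -/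
theorem hobs_one_eq_prob : Hobs D v i 1 = (triSitePercolation half).real (arcToCrossing D g o) := by
  unfold Hobs arcToCrossing
  rw [classCount_one_eq_card_blueCross hg ho hadj hst hv he,
    triSitePercolation_half_real_setOf_eq_card_div D.verts (fun σ => by rw [← inter_eq_inter_inter])]
  unfold BlueCross
  congr 2

open Classical in
/-- ★★★ **KhS eq. (4), PERCOLATION SIDE, `H₀`**: `H₀(z) = P_{1/2}[∂_{z y₁}Ω ↔ A₂ by a closed path]` (= the open-path probability by the
colour-flip symmetry of `P_{1/2}`; printed `P[∂_{j,j+1}Ω ↔ ∂_{z,j−1}Ω]·τ^{j+1}` with `u_{j+1} = y₀`). [cite: KhristoforovSmirnov2021, §2 eq. (4) (arXiv v1 p. 5) with §1.2 Lemma 2 (p. 3)] -/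
theorem hobs_zero_eq_prob : Hobs D v i 0 = (triSitePercolation half).real (arcFromClosedCrossing D g o) := by
  unfold Hobs arcFromClosedCrossing
  rw [classCount_zero_eq_card_yellowCross hg ho hadj hst hv he,
    triSitePercolation_half_real_setOf_eq_card_div D.verts (fun σ => by rw [← inter_compl_eq])]
  unfold YellowCross
  congr 2

/-- ★★★ **KHRISTOFOROV–SMIRNOV eq. (4) AS PRINTED, on the arc `A₀`**: `F(z) = P[∂_{z y₁} ↔ A₂ (closed)]·τ⁰ + P[∂_{y₀ z} ↔ A₁ (open)]·τ¹`
— both coefficients are crossing probabilities of critical site percolation on `G` and they sum to one. [cite: KhristoforovSmirnov2021, §2 eq. (4) (arXiv v1 p. 5)] -/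
theorem fobs_eq_crossingProbs :
    Fobs D v i = ((triSitePercolation half).real (arcFromClosedCrossing D g o) : ℂ) +
      tau * ((triSitePercolation half).real (arcToCrossing D g o) : ℂ) ∧
    (triSitePercolation half).real (arcFromClosedCrossing D g o) + (triSitePercolation half).real (arcToCrossing D g o) = 1 := by
  rw [← hobs_zero_eq_prob hg ho hadj hst hv he, ← hobs_one_eq_prob hg ho hadj hst hv he]
  exact ⟨fobs_of_stretch_zero hv he hg ho hst, hobs_zero_add_hobs_one_of_stretch_zero hv he hg ho hst⟩

end Dictionary

/-! ### the printed (open-colour) form of the `H₀` event: colour-flip symmetry of `P_{1/2}` -/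

section OpenForm

variable {D : TriMarkedDomain 3}
variable {g o : Site 2} (hg : g ∈ D.verts) (ho : o ∉ D.verts) (hadj : triGraph.Adj g o) (hst : D.stretchIdx₃ (D.dpos (g, o)) = 0)
  {v : HexVertex} (hv : AllSides D v) {i : Fin 3} (he : side v i = s(g, o))

/-- **the event `∂_{z y₁} ↔ A₂` in the open colour** (the printed `P^perc_Ω[∂_{j,j+1}Ω ↔ ∂_{z,j−1}Ω]`, `↔` = a blue path).
[cite: KhristoforovSmirnov2021, §2 eq. (4) (arXiv v1 p. 5)] -/
def arcFromCrossing (D : TriMarkedDomain 3) (g o : Site 2) : Set (SiteConfig (Site 2)) :=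
  {σ | ∃ a ∈ arcFrom D g o, ∃ b ∈ D.arc 2, PathIn triGraph ((D.verts : Set (Site 2)) ∩ σ) a b}

open Classical in
/-- **colour flip**: complementing the colouring inside `G` exchanges closed and open crossings, bijectively on the colourings of `G`.
[cite: KhristoforovSmirnov2021, §1.1 (arXiv v1 p. 2: the uniform measure on colourings)] -/
theorem card_filter_yellowCross_eq :
    #(D.verts.powerset.filter fun T => YellowCross D g o T) =
      #(D.verts.powerset.filter fun T : Finset (Site 2) => ∃ a ∈ arcFrom D g o, ∃ b ∈ D.arc 2,
        PathIn triGraph ((D.verts : Set (Site 2)) ∩ (↑T : Set (Site 2))) a b) := by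
  apply Finset.card_bij (fun T _ => D.verts \ T)
  · intro T hT
    rw [Finset.mem_filter, Finset.mem_powerset] at hT ⊢
    refine ⟨Finset.sdiff_subset, ?_⟩
    obtain ⟨-, a, ha, b, hb, hP⟩ := hT
    refine ⟨a, ha, b, hb, ?_⟩
    have hset : (D.verts : Set (Site 2)) ∩ (↑T : Set (Site 2))ᶜ = (D.verts : Set (Site 2)) ∩ (↑(D.verts \ T) : Set (Site 2)) := by
      ext x; simp only [Set.mem_inter_iff, Set.mem_compl_iff, Finset.mem_coe, Finset.mem_sdiff]; tauto
    rw [← hset]; exact hP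
  · intro T hT T' hT' h
    have h1 := Finset.mem_powerset.1 (Finset.mem_filter.1 hT).1
    have h2 := Finset.mem_powerset.1 (Finset.mem_filter.1 hT').1
    have : D.verts \ (D.verts \ T) = D.verts \ (D.verts \ T') := by rw [h]
    rwa [Finset.sdiff_sdiff_eq_self h1, Finset.sdiff_sdiff_eq_self h2] at this
  · intro T' hT'
    rw [Finset.mem_filter, Finset.mem_powerset] at hT'
    obtain ⟨hsub, a, ha, b, hb, hP⟩ := hT'
    refine ⟨D.verts \ T', ?_, Finset.sdiff_sdiff_eq_self hsub⟩
    rw [Finset.mem_filter, Finset.mem_powerset]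
    refine ⟨Finset.sdiff_subset, a, ha, b, hb, ?_⟩
    have hset : (D.verts : Set (Site 2)) ∩ (↑(D.verts \ T') : Set (Site 2))ᶜ = (D.verts : Set (Site 2)) ∩ (↑T' : Set (Site 2)) := by
      ext x; simp only [Set.mem_inter_iff, Set.mem_compl_iff, Finset.mem_coe, Finset.mem_sdiff]
      constructor
      · rintro ⟨hx, hn⟩; exact ⟨hx, by tauto⟩
      · rintro ⟨hx, hxT⟩; exact ⟨hx, fun h => h.2 hxT⟩
    rw [hset]; exact hP

include hg ho hadj hst hv he

open Classical in
/-- ★★★ **KhS eq. (4), PERCOLATION SIDE, `H₀`, printed (open) form**: `H₀(z) = P_{1/2}[∂_{z y₁}Ω ↔ A₂]` with `↔` an open path of `G`.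
[cite: KhristoforovSmirnov2021, §2 eq. (4) (arXiv v1 p. 5)] -/
theorem hobs_zero_eq_prob_open : Hobs D v i 0 = (triSitePercolation half).real (arcFromCrossing D g o) := by
  unfold Hobs arcFromCrossing
  rw [classCount_zero_eq_card_yellowCross hg ho hadj hst hv he, card_filter_yellowCross_eq]
  convert (triSitePercolation_half_real_setOf_eq_card_div (P := fun σ => ∃ a ∈ arcFrom D g o, ∃ b ∈ D.arc 2,
      PathIn triGraph ((D.verts : Set (Site 2)) ∩ σ) a b) D.verts fun σ => by rw [← inter_eq_inter_inter]).symm using 4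
  exact (Finset.filter_congr_decidable _ _ _).symm

/-- ★★★ **KHRISTOFOROV–SMIRNOV eq. (4) VERBATIM on `∂_jΩ = A₀`** (`u_{j+1} = y₀`, `u_{j−1} = y₁`, exponents shifted by the global `τ^{−j−1}` of
the tree's indexing): `F(z) = P^perc[∂_{z y₁}Ω ↔ A₂]·τ⁰ + P^perc[∂_{y₀ z}Ω ↔ A₁]·τ¹`, both `↔` open paths of critical site percolation on
`G`, the two probabilities summing to `1`. [cite: KhristoforovSmirnov2021, §2 eq. (4) (arXiv v1 p. 5)] -/
theorem fobs_eq_openCrossingProbs :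
    Fobs D v i = ((triSitePercolation half).real (arcFromCrossing D g o) : ℂ) +
      tau * ((triSitePercolation half).real (arcToCrossing D g o) : ℂ) ∧
    (triSitePercolation half).real (arcFromCrossing D g o) + (triSitePercolation half).real (arcToCrossing D g o) = 1 := by
  rw [← hobs_zero_eq_prob_open hg ho hadj hst hv he, ← hobs_one_eq_prob hg ho hadj hst hv he]
  exact ⟨fobs_of_stretch_zero hv he hg ho hst, hobs_zero_add_hobs_one_of_stretch_zero hv he hg ho hst⟩

end OpenForm

end Literature.Probability.Percolation.MarkedLoops
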